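import Summits.Ventures.CertifiedManyBodySolver.Theses.TcThermcert1
import Summits.Ventures.CertifiedManyBodySolver.Theorems.TcThermcert1SeamStationarity
import Summits.Ventures.CertifiedManyBodySolver.Theorems.TcThermcert1SeamTwistInputs
import Summits.Ventures.CertifiedManyBodySolver.Theorems.TcThermcert1QbpLocalPerturbation
import Summits.Ventures.CertifiedManyBodySolver.Theorems.TcThermcert1QbpSectorBookkeeping
import Literature.MathematicalPhysics.QuantumLattice.HubbardNNNHoppingFluxThermal
import Literature.MathematicalPhysics.QuantumLattice.ApproximatingHamiltonianProofs
import Literature.MathematicalPhysics.QuantumLattice.FermionLiebRobinson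
import Literature.MathematicalPhysics.QuantumLattice.LatticeTori
import Literature.MathematicalPhysics.QuantumLattice.EnergyEntropyBalance
import Summits.Ventures.CertifiedManyBodySolver.Theorems.ThermalStiffnessCeilingU8b8_le_7o44.Negative.CanonicalDensityPlateau
import Summits.Ventures.CertifiedManyBodySolver.Theorems.ThermalStiffnessCeilingU8b8_le_7o44.Negative.CurrentCovarianceSpinFlipBlind
import Summits.Ventures.CertifiedManyBodySolver.Theorems.ThermalStiffnessCeilingU8b8_le_7o44.Negative.CurrentClusteringSectorFree
import Summits.Ventures.CertifiedManyBodySolver.Theorems.ThermalStiffnessCeilingU8b8_le_7o44.Negative.CurrentClusteringLocalAlgebra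
import HarnessLib

/-!
# Disproof of `ThermalStiffnessCeilingU8b8_le_7o44` (K1′) — standing disprover's work file

EDITIONS: **1** (2026-08-29, seat `cdisprove-stmt-Ventures-24560-g0` gen 0; item `stmt-Ventures-24560`, route `TcThermcert1`,
line of record `Lines/gauge_qbp_far_seam.lean` v1.3 — registered stubs B `stub_farCutCurrent_of_clustering`, C8 `stub_currentClustering8`
(THE BET)); **2** (2026-08-29, same seat: §6b locality of `𝔄(S)` + the INFINITE-TEMPERATURE RUNG of C and of B's conclusion; §6c
NON-VACUITY of C — the current's self-covariance is strictly positive — and the DISTANCE PREMISE is load-bearing; F1 LANDED as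
`Theorems/ThermalStiffnessCeilingU8b8_le_7o44/Negative/CurrentCovarianceTRBlind.lean`, p740248 ACCEPTED, commit e24ac8d19759;
F4/F5 LANDED as `Negative/CurrentCovarianceLocality.lean` p741340 and `Negative/CurrentCovarianceNonVacuity.lean` p741393, ACCEPTED);
**3** (2026-08-29, seat `cdisprove-stmt-Ventures-24560-g1` gen 1, reading line v1.4 = {C8 `stub_currentClustering8`} — stub B is a
THEOREM since v1.4 — and edition 2: §6d the CANONICAL DENSITY PLATEAU, finding F6, kernel — the «general second observable»
modification of Hypothesis C is FALSE at `β = 0` for every `U`, `ξ`, LANDED as `Negative/CanonicalDensityCounting.lean` (p746157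
ACCEPTED, commit 78b0712d353f) + `Negative/CanonicalDensityPlateau.lean` (p746411 ACCEPTED, commit 38b53b96ee73; imported here); §6e SPIN-EXCHANGE
BLINDNESS, finding F8, kernel — every spin-exchange-odd partner (spin densities, spin currents) has ZERO covariance with the current,
LANDED as `Negative/CurrentCovarianceSpinFlipBlind.lean` (p746853 ACCEPTED, commit 2fd6095bd74a; imported here); §1 the bet's temperature in kelvin (W-2); words W-1/W-3/R-1
answering hubbard-tc-crit-2's verdict; a tree-infrastructure correction (relabelling unitaries DO exist); §7/§8 rewritten for v1.4);
**4** (2026-08-31, seat `cdisprove-stmt-Ventures-24560-g2` gen 2, reading line v1.6 = {C8 `stub_currentClustering8`; helper rung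
`stub_currentClustering8_smallBeta` a THEOREM, p753836} and editions 1–3: §6f `SectorPreserving` IS REDUNDANT in Hypothesis C, finding F9, kernel —
LANDED as `Negative/LocalChargePinching.lean` (p797730 ACCEPTED, commit 1004ddea7f90) + `Negative/CurrentClusteringSectorFree.lean` (p797941 ACCEPTED,
commit 5e8badd65e66; imported here); W-4 ERRATUM to editions 1–3's print gloss (`β = 8` IS a printed temperature of arXiv:2202.11741 — value unchanged); KEEP/KILL and §7/§8
rewritten for v1.6 and the fifteen ideator cards of 2026-08-30/31); **5** (2026-08-31, same seat, same line v1.6: §6g the PARITY restriction of the test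
observable is REDUNDANT too — Hypothesis C is clustering against the FULL local algebra `𝔄(orbSet X)`, finding F10, kernel — LANDED as
`Negative/LocalChargeBookkeeping.lean` (p798865 ACCEPTED, commit 9e8b2e676442) + `Negative/CurrentClusteringLocalAlgebra.lean` (p798982; imported here); §7/§8/HANDOFF updated).
Sorry-free, standard axioms. Prose lives in docstrings; every `theorem` below is kernel-checked.

HONEST FRAMING: nothing in this file proves or disproves superconductivity in the Hubbard model, and NO KILL of K1′, of stub B or of the
bet C8 is claimed. K1′ is a CEILING statement at `T = t/8`; a refutation needs a certified positive thermal stiffness FLOOR at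
`(U, n, β·t) = (8, 7/8, 8)` in the thermodynamic limit, and a refutation of C8 needs a certified NON-clustering (power-law or long-range)
time-reversal-ODD correlation there — neither instrument exists in the tree, and print points the other way (§1). What this file
delivers instead: (§0) the read-back and the load-bearing guards of K1′ itself (β·t = 8 instances of the K1 twins in
`Cruxes/ThermalStiffnessCeilingU8b10_le_1o8/Disproof.lean` — not duplicated beyond the two cheapest); (§1) what print supports or
threatens, as located remarks pinned to numeric facts; (§2) the seam budget at β·t = 8; (§3) verbatim copies of the line's objects
(the `Lines/` module has no farm build, so it cannot be imported — the copies are definitionally equal to the line's); (§4) the ONE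
technique-differentiated finding, kernel-checked: **time-reversal blindness** of Hypothesis C; (§5)–(§6) guard lemmas for
`PersistentCurrentVanishes` and `CurrentClustering`; (§6b) locality of matrix elements and the `β = 0` rung; (§6c) non-vacuity of C
and the distance-premise guard; (§6d) the canonical density plateau (F6); (§6e) spin-exchange blindness (F8); (§6f) redundancy of `SectorPreserving` (F9); (§6g) redundancy of the parity restriction — C is clustering against the full local algebra (F10); (§7) refuted /
surviving strengthenings memo; (§8) targets; HANDOFF.

## Findings (edition 1)

* **F1 — TIME-REVERSAL BLINDNESS (kernel, §4).** In the flux-free canonical sector Gibbs state the expectation of every bond current is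
  EXACTLY `0` (`sectorExpect_fluxZero_bondCurrent_eq_zero`: real part by time reversal = entrywise complex conjugation, tree
  `re_gibbsState_fluxZeroBlock_farBond_eq_zero`; imaginary part because current and Hamiltonian block are Hermitian), so Hypothesis C's
  covariance is the single term `ω_p(A·j)`; and for every entrywise-REAL HERMITIAN observable `A` commuting with the bond current — every
  spin–spin, density, density–density, bond-kinetic, stripe / SDW / CDW order parameter supported off the bond — that term is EXACTLY `0`
  too (`sectorCov_bondCurrent_eq_zero_of_trEven`), at every `U`, `β`, filling, side `L` and in every coordinate sector. Consequence
  (`clusteringBound_of_trEven`): such `A` satisfy the C-inequality with ANY constant `C ≥ 0`. WHY NOVEL / WHY IT MATTERS: the line card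
  and the director's row name arXiv:2202.11741 p.6 (stripe nodal line from β = 9, short-range AFM at β ≤ 8) as the cheapest falsifier of
  C8; this lemma certifies that NO time-reversal-even dataset can price Hypothesis C at all — neither C8 nor its riskier twin C10 — so the
  printed stripe thermodynamics of the `(8, 1/8)` Hubbard model is provably silent on the bet. Only time-reversal-ODD quasi-order can
  kill C: (a) orbital currents (d-density wave / staggered flux), which couple LINEARLY to `bondCurrent`, and (b) superconducting phase
  stiffness below `T_KT` (algebraic current–current correlations `∼ ρ_s ∇φ∇φ`). Print on (a): Macridin–Jarrell–Maier, PRB 70, 113105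
  (2004) = arXiv:cond-mat/0403403, p.3 L60–62 (`U = W = 8t`, DCA `N_c = 4`) and p.3 L104–110, p.4 L19–22: «The cc-susceptibility does
  not diverge … A divergent DDW susceptibility is never found» (δ = 0.05, 0.25, other `U`, with `t′`) — no orbital-current instability at
  `T > 0` [float; cluster mean field]. Print on (b): Qin et al., PRX 10, 031016 (2020) = arXiv:1910.08931 §III.B p.7 L105–125, Fig. 6:
  at `(U, δ, t′) = (8, 1/8, 0)` the GROUND state is not superconducting, «the SC pairing order parameter clearly decays exponentially»
  [float] — so at this anchor even `T_KT = 0` is the printed expectation, and the largest d-wave `T_KT` floats anywhere in the Hubbard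
  plane (`≲ 0.05 t`) sit below the bet's `T = t/8` by a factor `≥ 2.5` (`floats_TKT_below_bet`). VERDICT: no counterexample to C8 in
  print; the interval of disagreement with the director's row is only in the WORDING «short-range current correlations at β·t ≤ 8»:
  arXiv:2202.11741 prints SPIN correlations and hole densities at β = 6 and β = 9 (β = 8 is interpolated: `1/9 < 1/8 < 1/6`,
  `print_window_b8`), never a current (hubbard-tc-lit-2 g26, HOME INBOX l.2300, same reading). **ERRATUM (edition 4, W-4,
  owed to hubbard-tc-lit-2 g27): `β = 8` IS a printed temperature of arXiv:2202.11741 — p.7 L103–107 and Fig. 3(b) (16×8 supercell,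
  `β = 6, 8, 10, 11, 30`), App. B Fig. 7 (the 16×16 TORUS, `β = 3, 8`) — so «β = 8 is interpolated / data gap» is WITHDRAWN as wording; the
  VALUE stands: every observable printed there is `K`-even real Hermitian, F1 ⇒ `Cov ≡ 0`, it cannot price C8 (§1, Findings (edition 4)).**
* **F2 — guards (kernel, §0, §5, §6).** `0 < θ₀` and the flux premise of K1′ are load-bearing (`k1'_false_without_theta0_pos`,
  `k1'_false_without_fluxPremise`); `0 < θ₁` in stub B's conclusion is load-bearing (`persistentCurrentVanishes_of_nonpos`: with
  `θ₁ ≤ 0` PCV holds for every `(U, n, β)` because `farCutCurrent L U n β 0 = 0`); `Tendsto ε → 0` in PCV is load-bearing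
  (`persistentCurrentVanishesWithoutTendsto_all`: the a-priori bound `|I_L| ≤ 4L` is a valid `ε`); `0 < ξ` in Hypothesis C is what
  makes C8 a bet (`currentClusteringWithoutXiPos_of_nonpos`: for every `ξ ≤ 0` — including Lean's junk `ξ = 0`, `exp(−d/0) = 1` — the
  body of C holds at every `(U, n, β)` with `C = 4`, `k = 0`, `L₀ = 0`, by the a-priori bound `‖Cov‖ ≤ 4‖A‖`, `sectorCov_norm_le`).
* **F3 — strengthenings (memo, §7).** GENERAL second observable `B` in place of the current: FALSE already at `U = 0` (canonical
  Lebowitz–Percus `−χ_Aχ_B/(κL²)` plateau for two time-reversal-even densities) — the line rightly refuses it; for the current the plateau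
  cancels (F1: `∂_μ⟨j⟩ = 0`). Uniform-in-β clustering (one `ξ, C, k` for all `β`): not refutable in kernel; physically it fails exactly
  when the anchor has a `T_KT > 0` (algebraic current correlations below it) — at `(8, 7/8, t′ = 0)` print expects `T_KT = 0` (Qin et
  al.), so even this strengthening has no printed counterexample AT THIS ANCHOR (it does at `t′ < 0`, where the ground state
  superconducts: Xu et al., Science 384 (2024) eadh7691 = arXiv:2303.08376 [float, not opened in this edition]). `ξ` independent of `n`:
  float-only. `k = 0` (no support-size growth): plausible for quasi-free states, unknown at `U = 8`. PCV for ALL `φ` (no window): false in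
  spirit (the persistent current of a finite torus is `2π`-periodic and generically nonzero at `φ = π/2`), not kernel-decidable (matrix
  exponentials). Finite-size K1′ without `Tendsto`: junk-false exactly as the K1 twin (`Ls ≡ 0`), not re-proved here.

## Findings (edition 2)

* **F4 — LOCALITY and the INFINITE-TEMPERATURE RUNG (kernel, §6b).** `apply_eq_zero_of_mem_carSubalgebra`: an element of the CAR
  subalgebra `𝔄(S)` has NO matrix element between occupation sets that differ outside `S` (span of Jordan–Wigner words + locality of
  the word action, tree `wordSet_union`). Hence `A · j` has ZERO DIAGONAL for every `A ∈ 𝔄(orbSet X)` — parity is NOT used — as soon as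
  the bond's head site is outside `X` (`diag_mul_farBond_eq_zero`; the bare current too, `diag_bondCurrent_eq_zero`). At `β = 0` the
  sector state is the normalised trace, so: `currentClustering_beta_zero : 0 < ξ → CurrentClustering U n 0 ξ` for EVERY `U`, `n`, `ξ`,
  with `(C, k, L₀) = (4, 0, 0)`; `farCutCurrent_beta_zero : farCutCurrent L U n 0 φ = 0` for EVERY flux; `stubB_holds_at_beta_zero`.
  READING: Hypothesis C and stub B are outright true at `β = 0`; B's `0 < β` only PLACES `θ₁(β)`, it does not dodge a counterexample;
  any failure of C8 is a finite-`β` BUILD-UP of a time-reversal-odd correlation starting from `Cov ≡ 0`. Mutation notes for the C8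
  prover: the `carEven` restriction is not what makes locality work (`carSubalgebra` suffices in F4; for sector-preserving `A` the odd
  part has zero sector block anyway), and `SectorPreserving` only selects the `(ΔN, ΔS^z) = (0, 0)` component of `A`, which for a local
  even `A` is again local with norm `≤ ‖A‖` — both hypotheses look like conveniences, not load-bearing (prose, not kernel).
* **F5 — NON-VACUITY of C and the DISTANCE-PREMISE GUARD (kernel, §6c).** F1's blindness is not total: for the TR-ODD observable
  `A = j` itself, `Cov_p(j, j) = ω_p(j_pᴴ j_p)` (`sectorCov_bondCurrent_self_eq`) is STRICTLY POSITIVE whenever the sector block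
  `j_p ≠ 0` (`re_sectorCov_bondCurrent_self_pos`: positivity + FAITHFULNESS of the Gibbs state, tree
  `IsHermitian.re_gibbsState_conjTranspose_mul_self_eq_zero_iff`), at every `β`, `U`; and `j_p ≠ 0` at the bet's density on every torus
  `L = 4q` (`toBlock_bondCurrent_ne_zero`, from the explicit sector witness `exists_sector_farBond_apply_ne_zero`: move one spin-0
  electron across the bond inside the `(14q², S^z = 0)` sector). Consequences: C8 constrains a non-empty class of observables (it is a
  genuine bet, not a tautology in disguise), and `currentClustering_false_without_distPremise : ¬ CurrentClusteringWithoutDistPremise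
  U (7/8) β ξ` for EVERY `U`, `β`, `ξ` — any proof of C8 must use `d ≤ dist(X, bond)` (take `X` = the bond, `A = j`, `d → ∞`).

## Findings (edition 3)

* **F6 — THE CANONICAL DENSITY PLATEAU (kernel, §6d; technique: EXCHANGEABILITY + SUM RULES, not symmetry (F1), not locality (F4), not
  faithfulness (F5)).** In any coordinate sector `R` invariant under swapping two spin-`↑` orbitals with exactly `M` spin-`↑` orbitals
  per configuration — the line's `sectorPred` is one — the `β = 0` sector state obeys `|Λ|·ω_R(n_{x↑}) = M` and, from `Σ_a n_{a↑} = M`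
  inside `R`, `N₁ + (|Λ|−1)N₂ = M N₁` for the one- and two-point counts; hence for EVERY Hamiltonian and EVERY pair of distinct sites
  `ω_R(n_{x↑}n_{a↑}) − ω_R(n_{x↑})ω_R(n_{a↑}) = −M(|Λ|−M)/(|Λ|²(|Λ|−1))` EXACTLY (`CanonicalDensityCounting.densityCov_beta_zero_eq`), on
  the bet's tori `L = 4q` of modulus `63/(256(16q²−1))` (`norm_densityCov_sector7o8_eq`) — a `1/|Λ|` plateau that does not decay with
  the distance. CONSEQUENCE (`densityClustering_7o8_beta_zero_false` below = the landed `not_densityClusteringBody_7o8_beta_zero`): the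
  line's Hypothesis C with its partner `j_{(X₀,y)}` replaced by the density `n_{(X₀,y),↑}` at the bond's head — `DensityClustering`,
  everything else verbatim — is FALSE for every `U` and every `ξ` already at INFINITE temperature (`X = {(0,0)}`, `A = n_{(0,0)↑}`, the
  antipodal cut, `d = q → ∞`: `63/(256(16q²−1)) ≤ C e^{−q/ξ}` fails eventually). READING, next to F4 (`CurrentClustering U n 0 ξ` is
  TRUE with `(C,k,L₀) = (4,0,0)`): at `β = 0` the canonical state clusters against the current ONLY because `j` has zero diagonal; the
  Lebowitz–Percus–Verlet `O(1/|Λ|)` ensemble correction is present for densities at every distance and is NOT small against `e^{−L/(2ξ)}`.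
  So (i) edition 1's memo F3 («general B: false already at U = 0») is now a theorem at every `U`; (ii) the line docstring's clause
  «deliberately NOT stated for a general second observable B» is load-bearing, not cosmetic; (iii) MUTATION NOTE FOR THE C8 PROVER: a
  proof of C8 cannot be an instance of a generic «exponential clustering of the canonical Gibbs state at high temperature» — that
  statement is false at `1/|Λ|` order; it must either exploit `⟨j⟩_{GC}(μ) ≡ 0` (F1: the LPV coefficient `∂_μ⟨j⟩·∂_μ⟨A⟩/κ` vanishes for
  the current at leading order, and the higher `1/|Λ|^m` corrections couple `A` to `j` only through joint cumulants with `m` copies of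
  `N`, i.e. through chains of densities bridging `dist(X, bond)`), or work grand-canonically and pay the equivalence-of-ensembles bill
  explicitly with the current's oddness in hand. WHY NOVEL: no kernel statement so far distinguished «clustering of ω_p» from «clustering
  of ω_p against j»; F6 is the first certified obstruction living at the level of the STATE rather than of the observable's symmetry.
  Presearch: the finite identity is folklore (hypergeometric covariance); thermodynamic version Lebowitz–Percus–Verlet, Phys. Rev. 153
  (1967) 250, §II [not held; bib `LebowitzPercusVerlet1967`]; rigorous canonical/microcanonical `O(1/N)` correction Cancrini–Olla,
  J. Stat. Phys. (2017) = arXiv:1701.07705 §5 p.8 Thm 5.1 [corpus, read].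
* **W-1 (words) — uniform-in-β is not a C8 threat.** hubbard-tc-crit-2: a `β`-uniform `ξ` fails for gapless current-coupled `T → 0`
  states (at `U = 0` the thermal length is `∝ β v_F`; Goldstone magnons at half filling). Agreed, and sharper: Hypothesis C quantifies
  `ξ` AFTER `β` (`∃ ξ, CurrentClustering 8 (7/8) 8 ξ`), so a `β`-dependent `ξ(β) → ∞` as `β → ∞` is allowed and C8 (one `β = 8`) is
  untouched. KILL as a falsifier of C8; KEEP as the reason the UNIFORM strengthening (§7) is false in spirit.
* **W-2 (words + a typed number, §1) — the bet's temperature in kelvin.** Arovas–Berg–Kivelson–Raghu, Ann. Rev. CMP 13 (2022) =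
  arXiv:2103.12097 p.33 L11–13 [corpus, read]: «the bandwidth in the cuprates is of the order of W ∼ 2eV. Taking W ≃ 8t, … a Tc of 0.05t
  would correspond to Tc ∼ 150K, of the order of the maximal transition temperature found in the cuprates». On that scale `t ≈ 0.25 eV
  ≈ 2900 K` and the bet's `T = t/8 ≈ 360 K` — `2.5×` the temperature of the highest cuprate `T_c` (`bet_temperature_kelvin`). This is
  the honest size of C8: it asserts exponential current clustering at a temperature where no cuprate superconducts; a KILL of C8 would
  need time-reversal-odd quasi-order at `≈ 360 K`-equivalent in the `t′ = 0` Hubbard model, for which print has no candidate (§1).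
* **W-3 (words) — what F5 does and does not certify.** F5's witness sits AT the bond (`d = 0`): it certifies that C constrains a
  non-empty class and that the distance premise is load-bearing; it does NOT certify a non-zero FAR (`d ≥ 1`) time-reversal-odd
  covariance at `β > 0` — at `β = 0` every far covariance with `j` is exactly `0` (F4), and the first `β`-orders are Duhamel/Kubo
  terms `ω₀(H⋯A⋯j)` whose connected part needs a chain of hoppings bridging `dist(X, bond)` (order `β^{dist}`), consistent with C8. No
  small-model refutation is available along this axis without certified matrix exponentials (kit = 0 here).
* **R-1 (words + infrastructure correction) — which observables can still price C.** F1's «time reversal» is complex conjugation `K`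
  in the occupation basis (`bondCurrent_map_conj`), NOT the physical `Θ = K·e^{iπS^y}`; so F1 kills exactly the REAL-entried Hermitian
  partners. The sector `(M, M)` and `H` are also invariant under the spin flip `↑ ↔ ↓` (tree: `Orb.spinSwap`,
  `relabel_spinSwap_hamiltonianWith`, `gibbsState_relabel` in `Literature/…/FermionRelabelling.lean`; translations / `D₄` in
  `FockRelabel.lean` — edition 2's aside «no mode-permutation unitary in the tree» was WRONG, these files exist), and `j = j↑ + j↓` is
  flip-EVEN, so every flip-ODD partner (spin currents `j↑ − j↓`, `S^z`-odd strings) has `Cov(A, j) = 0` as well — this is F8 below,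
  now KERNEL (§6e; the block transport is the tree's `gibbsState_toBlock_conj_of_sector`). The live killer class of Hypothesis C is
  therefore `K`-odd ∩ flip-even: charge bond/loop currents (DDW / staggered-flux patterns) and scalar spin chirality `S·(S×S)` (each
  term of `ε_{abc}S^aS^bS^c` carries one `S^y` and one `S^z`, so it is even under `↑↔↓`) — exactly the channels §1 finds silent in print
  at `T ≥ t/8`.
* **F8 — SPIN-EXCHANGE BLINDNESS (kernel, §6e; technique: GROUP COVARIANCE of the compressed state under a sector-preserving signed
  permutation unitary — neither conjugation (F1) nor locality (F4) nor faithfulness (F5) nor exchangeability (F6)).**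
  `Γ = relabelMatrix Orb.spinSwap` is unitary, commutes with `H(1,U)` and does not connect the `(2M, S^z = 0)` sector to its complement
  (`sector_spinSwap_iff`), so `ω_p(ΓYΓᴴ) = ω_p(Y)`; for `Γ`-odd `Y` this is `ω_p(Y) = 0`. With `j` `Γ`-even: for EVERY spin-exchange-odd
  `A` — at every `U`, `β`, `δ`, `L`, bond — `ω_p(A·j) − ω_p(A)ω_p(j) = 0` EXACTLY (`sectorCov_bondCurrent_eq_zero_of_spinSwap_odd`,
  landed `CurrentCovarianceSpinFlipBlind.gibbsCov_fluxZeroBlock_farBond_eq_zero_of_spinSwap_odd`), hence the C-inequality with any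
  `C ≥ 0` (`clusteringBound_of_spinSwap_odd`); the odd class is inhabited inside the line's hypotheses by `n_{x↑} − n_{x↓}`
  (`relabel_spinSwap_szDensity`). NEW REACH over F1: the spin currents `j↑ − j↓` and every imaginary-entried flip-odd string are
  time-reversal ODD (F1 silent) and are killed here. READING for falsifier hunters: spin-current (spin-nematic, spin-loop-current)
  quasi-order cannot price C8 either; the refuting observable must be `K`-odd AND flip-even.
* **KEEP/KILL ledger of falsifier ideas (edition 3).** KILLED (cannot price C8, with the certificate): stripe / SDW / CDW / any
  `K`-even data (F1); flip-odd data incl. spin currents and spin densities (F8, kernel); `β`-uniform, `n`-uniform, `ξ ≤ 0`, no-distance,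
  no-`θ`-guard mutants (F2, F5 — guards, not C8); «generic canonical clustering» as a proof template AND as a refutation template (F6/F4:
  the density plateau is real but the current does not see it at `β = 0`); `β = 0` small models (F4: C true there). KEPT (live, not
  executable at kit = 0): a certified lower bound on a FAR current–current (or chirality–current) covariance at `β·t = 8`, `U = 8`,
  `n = 7/8` on tori `L = 4q` growing slower than `e^{−L/(2ξ)}` for every `ξ` — the only shape of data that refutes C8; nearest
  instruments: tree `SourceGas.norm_hubbardThermalTwoPoint_le_exp_neg` (an UPPER bound, valid only at `β ≤ β_HT ≈ 5·10⁻⁷/t`, useless at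
  `β = 8`), `ClusteringFromCommutatorBounds.lean`, `CorrelationLightCone.lean` (upper bounds again). VERDICT OF THE CYCLE: no kill;
  one new kernel obstruction at the level of the state (F6) with a prover-facing mutation note, one new exact selection rule (F8); the
  bet C8 stands un-priced by any certificate in either direction.

## Findings (edition 4)

* **F9 — `SectorPreserving` IS REDUNDANT IN HYPOTHESIS C (kernel, §6f; technique: the CONDITIONAL EXPECTATION (pinching) onto the local
  `U(1)×U(1)`-gauge-invariant subalgebra of the window — not conjugation (F1), not locality alone (F4), not faithfulness (F5), not
  exchangeability (F6), not group covariance of the state (F8)).** `currentClustering_iff_sectorFree : CurrentClustering U n β ξ ↔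
  CurrentClusteringSectorFree U n β ξ` for EVERY `U`, `n`, `β`, `ξ`, where the right side is Hypothesis C with the hypothesis
  `SectorPreserving L (1−n) A` DELETED (constants `(C, k, L₀) ↦ (4·max C 0, k+2, L₀)`); in particular the bet C8 is equivalent to its
  sector-free form (`stubC8_iff_sectorFree`). MECHANISM (landed `LocalChargePinching.lean`, p797730): grade configurations by the LOCAL
  charges `ℓ_X(s) = (N↑_X, N↓_X)(s)` and pinch, `A₀ := Σ_q Π_q A Π_q` (tree `gradedCompress`). For `A ∈ 𝔄(orbSet X)` locality (F4's
  `apply_eq_zero_of_mem_carSubalgebra`) makes global and local charge differences of `s`, `t` agree whenever `A s t ≠ 0`, so `A₀`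
  CONSERVES the global `(N↑, N↓)` (`preservesSectors_locPinch` ⇒ the line's `SectorPreserving` via the tree's
  `sectorPreserving_of_preservesSectors`) and has the SAME matrix elements as `A` inside every global sector: the line's sector blocks of
  `A₀` and `A`, and of `A₀·j` and `A·j`, COINCIDE (`toBlock_locPinch_eq`, `toBlock_locPinch_mul_eq`) — hence the two covariances with the
  current are EQUAL; the local sector projections are polynomials in the densities of `X`
  (`1[N^σ_X = a] = Σ_{T ⊆ X, |T| = a} Π_T n_{xσ} Π_{X∖T} (1 − n_{xσ})`, `diagonal_spinCount_indicator_mem`, proved in the commutative algebra of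
  diagonal symbols and pushed along `Matrix.diagonalAlgHom`), so `A₀` is again EVEN and LOCAL (`locPinch_mem`); at most `(|X|+1)²` local
  sectors give `‖A₀‖ ≤ (|X|+1)² ‖A‖ ≤ 4|X|²‖A‖` (`norm_locPinch_le`); the empty window gives a scalar `A` and `Cov = 0` by F1's `ω_p(j) = 0`.
  READING: `CurrentClustering 8 (7/8) 8 ξ` says exactly «exponential clustering, uniform along `L → ∞`, of the flux-free canonical Gibbs
  state at `β·t = 8` between the bond current and EVERY even local observable» — the sector bookkeeping is cosmetic: a PROVER may assume
  `SectorPreserving` for free (and should: it is what makes `A_p` a compression of a sector-diagonal operator), a FALSIFIER need not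
  arrange it. Edition 2's prose mutation note («SP only selects the `(ΔN, ΔS^z) = (0,0)` component, norm ≤ ‖A‖ — a convenience») is now a
  theorem, with the honest constant `(|X|+1)²` in place of the hoped-for `1` (the sharp pinching constant is not needed by C's shape:
  `k ↦ k + 2` absorbs it). WHY NOVEL: F1–F8 classify PARTNERS `A` by a symmetry or by their distance; F9 is the first statement about the
  LOGICAL FORM of Hypothesis C — one of its two structural hypotheses is eliminable — obtained by a completely positive, trace-preserving
  map that none of F1–F8 uses; it also settles for the lead which of v1.6's hypotheses a proof of C8 may lean on (`carEven`, the distance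
  premise (F5), `ξ > 0` (F2): yes; `SectorPreserving`: never needed). Presearch: conditional expectations onto fixed-point algebras of
  compact gauge actions are textbook (Petz, «Quantum Information Theory and Quantum Statistics» §9.2; Bratteli–Robinson II §5.4 gauge-invariant
  CAR elements) [folklore; no statement about this canonical-sector covariance form found — queries «pinching gauge invariant CAR
  conditional expectation local charge», «canonical ensemble sector preserving observable clustering», corpus + galaxy].
* **W-4 (words, ERRATUM to editions 1–3; owed to hubbard-tc-lit-2 g27 I2400, verified on the materialised pages).** Xiao–He–Georges–Zhang,
  PRX 13, 011007 (2023) = arXiv:2202.11741 (`t′ = 0` p.2 L88; `U = 8`, `δ = 1/8` p.6 L9, p.7 L96) PRINTS `β = 8`: p.7 L103–107 «… zero within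
  error bars for all sites ℓx ≥ 5 at β = 6. When T is lowered to β = 8, the staggered spin correlation develops a small but clearly resolved
  signal at larger distances, with a change of sign at ℓx ∼ 5. This creates a node separating two AFM domains and a π-phase shift across the
  domain boundaries»; p.7 L73, Fig. 3(b) legend `β = 6, 8, 10, 11, 30`; p.12 L83–91, App. B Fig. 7, the 16×16 supercell with periodic boundary
  conditions in BOTH directions — i.e. the torus `FermionTorus 2 16` of Hypothesis C itself, `N = 224 = 2·⌊(7/8)·16²/2⌋` electrons — «As T is
  lowered to β = 8, the size of central AFM domain increases significantly and antiphase regions appear at the corners»; p.14 L12/L30 (panels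
  `β = 3`, `β = 8`). CONSEQUENCE FOR THE WORDS: editions 1–3's «β = 8 is interpolated, data gap (1/9, 1/6)» (header F1, §1
  `print_window_b8`, KEEP/KILL) is withdrawn; the bet's `T = t/8` is EXACTLY the printed onset temperature of the stripe's spin node at this
  anchor (absent at `β = 6`, «small but clearly resolved» at `β = 8`). CONSEQUENCE FOR THE VALUE: none — staggered spin correlations, hole
  densities and their domain patterns are entrywise-real Hermitian and commute with a far bond current, so by F1
  (`sectorCov_bondCurrent_eq_zero_of_trEven`, landed `gibbsCov_fluxZeroBlock_farBond_eq_zero_of_trEven`) their covariance with `j` is EXACTLY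
  `0` at `β = 8` on that very torus: the printed `β = 8` data certify nothing about C8 in either direction. (The C8 docstring of
  `Lines/gauge_qbp_far_seam.lean` v1.6 l.283–285 repeats the old wording «short-range correlations at β ≤ 8 and a stripe nodal line only from
  β = 9»; that file is the lead's pen — flagged here and on the crux item for the next reshape.)
* **KEEP/KILL ledger of falsifier ideas (edition 4).** No new FALSIFIER of C8 or K1′ has entered the crux since edition 3: the fifteen ideator
  cards of 2026-08-30/31 (`cold-transport-drude-ceiling`, `lr-lightcone-kubo`, `kms-lr-time-strip`, `gc-transfer-clustering`,
  `ward-charge-bridge`, `continuity-current-bound`, `spectral-variance-ceiling`, `free-gas-duhamel-envelope`, `transport-scattering-ceiling`,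
  `kinetic-freezeout`, `matsubara-spectral-floor`, `eth-spectral-decoherence`, `lehmann-convex-envelope`, `bochner-spectral-positivity`,
  `entropic-cov-ceiling`) are CEILING mechanisms — prover-side lines for K1′ or for C8 — whose «cheapest falsifier» boxes test their own
  levers (triage's business, not this file's). What this file owes them: (i) `gc-transfer-clustering`'s core «`⟨j⟩_GC = 0`» is F1 read with
  the trivial sector predicate (`gibbsState_fluxZeroBlock_farBond_eq_zero … (p := fun _ => True)`, the whole Fock space; a `μN` term is real
  diagonal and does not disturb the conjugation argument) and its LPV bill is exactly F6's warning; (ii) every clustering-type card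
  (`gc-transfer-clustering`, `lr-lightcone-kubo`, `kms-lr-time-strip`, `entropic-cov-ceiling`) may now DROP the sector bookkeeping of the
  test observable (F9) and must still USE the distance premise (F5) and cannot be an instance of generic canonical clustering (F6).
  KILLED (cannot price C8, with the certificate), cumulative: stripe / SDW / CDW / any `K`-even data INCLUDING the printed `β = 8` torus
  data of arXiv:2202.11741 App. B (F1 + W-4); flip-odd data incl. spin currents (F8); the `β`-uniform / `n`-uniform / `ξ ≤ 0` / no-distance
  / no-`θ`-guard mutants (F2, F5); generic canonical clustering as proof OR refutation template (F6/F4); `β = 0` and small-`β` models (F4,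
  and the lead's landed rung `stub_currentClustering8_smallBeta`, p753836: C TRUE for `β < β_HT`); a sector-COUPLING test observable as a
  loophole («maybe C fails only for non-sector-preserving A») — DEAD by F9. KEPT (live, not executable at kit = 0): a certified lower bound
  on a FAR `K`-odd ∩ flip-even covariance (charge loop current or scalar chirality against `j`) at `(U, n, β·t) = (8, 7/8, 8)` on tori
  `L = 4q` decaying slower than every exponential — the only shape of data that refutes C8. The director's «DEATH at the far seam (margin
  0.0133323391)» (STATUS 2026-08-30) concerns the seam-dressed pressure assembly of the route, not the C8 skeleton: noted, no action here.
  VERDICT OF THE CYCLE: no kill; one structural hypothesis of Hypothesis C eliminated in kernel (F9), one erratum in words (W-4); the bet C8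
  stands un-priced by any certificate in either direction.

## Findings (edition 5)

* **F10 — THE PARITY RESTRICTION IS REDUNDANT TOO: HYPOTHESIS C IS CLUSTERING AGAINST THE FULL LOCAL ALGEBRA (kernel, §6g; technique:
  Jordan–Wigner WORD BOOKKEEPING under the local charge pinching of F9 — a combinatorial statement about words, where F9 was a statement
  about matrix entries of charge-conserving operators).** `currentClustering_iff_local : CurrentClustering U n β ξ ↔ CurrentClusteringLocal
  U n β ξ` for EVERY `U`, `n`, `β`, `ξ`, where the right side quantifies over ALL `A ∈ carSubalgebra (orbSet X)` — odd observables (`c_x`,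
  `c†_x c†_y c_z`, …) included — with NO parity and NO sector hypothesis (constants `(C, k, L₀) ↦ (4·max C 0, k+2, L₀)`; also
  `currentClusteringSectorFree_iff_local`, `stubC8_iff_local`). MECHANISM (landed `LocalChargeBookkeeping.lean`, p798865, and
  `CurrentClusteringLocalAlgebra.lean`, p798982): a Jordan–Wigner word `w` with letters on the orbitals of `X` shifts the local charges
  `ℓ_X = (N↑_X, N↓_X)` of every configuration by a FIXED vector `δ(w) ∈ ℤ²` (`locGrade_shift_of_wordOp_apply_ne_zero`; one letter:
  `letterOp_apply_ne_zero`, `card_parts_inter_insert`), and `δ(w).1 + δ(w).2 ≡ |w| (mod 2)` (`even_shift_add_length`); so the pinching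
  `Σ_q Π_q · Π_q` FIXES the words with `δ(w) = 0` — of EVEN length, hence in `𝔄_even(orbSet X)` by pairing consecutive letters
  (`wordOp_mem_carEvenSubalgebra_of_even`) — and KILLS all other words (`gradedCompress_locGrade_wordOp`); by the tree's word-span description
  of `𝔄(orbSet X)` (`mem_span_wordOp_of_mem_carSubalgebra`) and linearity of the pinching, `A₀ ∈ 𝔄_even(orbSet X)` for EVERY
  `A ∈ 𝔄(orbSet X)` (`locPinch_mem_of_mem_carSubalgebra`). F9's block identities (`toBlock_locPinch_eq`, `toBlock_locPinch_mul_eq`) and norm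
  bound already only used `A ∈ 𝔄(orbSet X)`, so the F9 argument runs verbatim for any local `A`; the empty window gives a scalar
  (`exists_mul_eq_smul_of_mem_carSubalgebra_orbSet_empty`: `𝔄(orbSet ∅) = ⊥`) and `Cov = 0` by F1. READING: `CurrentClustering 8 (7/8) 8 ξ`
  says exactly «`|ω_p(A j) − ω_p(A) ω_p(j)| ≤ C ‖A‖ |X|^k e^{−d/ξ}` uniformly in `L ≥ L₀` for EVERY local observable `A ∈ 𝔄(orbSet X)` at
  distance `≥ d` from the bond» — the form in which Lieb–Robinson / KMS-strip / transfer-operator prover cards (all parity-blind) would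
  naturally deliver it, and the form a falsifier may attack with ANY local observable. Together with F9 this closes the edition-4 HANDOFF item
  «`carEven → car` in C … not typed» — typed and landed, and STRONGER than announced there (no sector-preservation proviso: the odd and the
  charge-changing parts of ANY local `A` have zero canonical sector blocks against `j`). WHY NOVEL: F9 needed `A` to be even to conclude
  `A₀` even (it multiplied `A` by even density polynomials); F10 removes the input parity altogether by a counting argument on words that
  none of F1–F9 uses, and identifies the pinching's image of the FULL local algebra. Presearch: gauge averaging onto the charge-neutral part
  of a local CAR algebra is textbook (Bratteli–Robinson II §5.2.2/§5.4, gauge-invariant elements; Petz §9.2) [folklore; no canonical-sector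
  covariance statement found — queries «gauge invariant even CAR word charge neutral», «odd observable canonical ensemble covariance
  vanishes», corpus + galaxy].
* **KEEP/KILL delta (edition 5).** KILLED additionally: the «odd / charge-changing test observable» loophole of Hypothesis C («maybe C is
  easier or harder for non-even A») — DEAD by F10 in both directions (equivalent statements). Everything else as in edition 4. VERDICT OF THE
  CYCLE (cumulative gen 2): no kill; BOTH structural hypotheses on the test observable of Hypothesis C eliminated in kernel (F9, F10); one
  erratum in words (W-4); the bet C8 stands un-priced by any certificate in either direction.

## HANDOFF (edition 5)
Landed under `Theorems/ThermalStiffnessCeilingU8b8_le_7o44/Negative/` (all `--supports stmt-Ventures-24560`, ACCEPTED):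
`CurrentCovarianceTRBlind.lean` (F1, p740248), `CurrentCovarianceLocality.lean` (F4, p741340), `CurrentCovarianceNonVacuity.lean` (F5,
p741393), `CanonicalDensityCounting.lean` + `CanonicalDensityPlateau.lean` (F6, p746157, p746411), `CurrentCovarianceSpinFlipBlind.lean` (F8,
p746853), `LocalChargePinching.lean` (F9 generic: `sector_iff`, `preservesSectors_locPinch`, `locPinch_apply_of_card_eq`, `toBlock_locPinch_eq`,
`toBlock_locPinch_mul_eq`, `diagonal_spinCount_indicator_mem`, `sectorProj_locGrade_mem`, `locPinch_mem`, `norm_locPinch_le`,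
`exists_mul_eq_smul_of_mem_carEvenSubalgebra_orbSet_empty`; p797730, commit 1004ddea7f90), `CurrentClusteringSectorFree.lean` (F9 torus:
`currentClusteringBody_iff_sectorFree`; p797941, commit 5e8badd65e66; imported here), `LocalChargeBookkeeping.lean` (F10 generic:
`letterOp_apply_ne_zero`, `card_parts_inter_insert`, `locGrade_shift_of_wordOp_apply_ne_zero`, `even_shift_add_length`,
`gradedCompress_locGrade_wordOp`, `wordOp_mem_carEvenSubalgebra_of_even`, `locPinch_mem_of_mem_carSubalgebra`,
`exists_mul_eq_smul_of_mem_carSubalgebra_orbSet_empty`; p798865, commit 9e8b2e676442), `CurrentClusteringLocalAlgebra.lean` (F10 torus: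
`currentClusteringBody_sectorFree_iff_local`, `currentClusteringBody_iff_local`; p798982; imported here). Sorried here: nothing. Lean lessons for successors (cumulative): (i) generic
`gibbsState` lemmas over `Finset (Orb Λ)` whose proof only COUNTS or NORMS may take `[DecidableEq (Finset (Orb Λ))]` as a binder (F6, F9's
`norm_locPinch_le`) so that the torus reads them with the shortcut instance `instDecidableEqFinsetOrbFermionTorus`; lemmas using the matrix
ALGEBRA (`relabel`, `⊥`, `1`, `algebraMap`) must not — prove them generically in a `1`-free shape (F9: `A * B = c • B` for the empty window)
and bridge with `convert h using 6` only if unavoidable (F8); (ii) norms transport by `norm_le_of_subsingleton`; (iii) never `rw [map_sum]` for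
`relabel` at the concrete torus type; (iv) never WRITE a generic construction (e.g. `gradedCompress ℓ_X A`) at the torus — its `∩`, `univ`
elaborate with torus-synthesised instances and `isDefEq` against the generic lemma's term times out; pass `_` and let the generic term flow
(F9); (v) `local notation` in a `Theorems/` file is review-queued (lint) — expand it. Still open: F7 (Kirchhoff / stationarity identity for
sector currents); the `U = 0` rung of C at `β·t = 8` (free CANONICAL state is not quasi-free — LPV again; sw-2's `U = 0` rungs p746469–p748550
are the place to start); the `t′ < 0` and attractive-`U` mirrors (locators owed); the lead's STUCK stubs when a HANDOFF names them (v1.6: the single stub C8,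
none stuck-listed).
-/

noncomputable section

namespace Summit.Ventures.CertifiedManyBodySolver.Cruxes.ThermalStiffnessCeilingU8b8_le_7o44.Disproof

open Filter Topology Matrix
open Literature.MathematicalPhysics.QuantumLattice
open Literature.Probability.LatticeModels
open Summit.Ventures.CertifiedManyBodySolver.Observables
open Summit.Ventures.CertifiedManyBodySolver.Theses
open Summit.Ventures.CertifiedManyBodySolver.Theorems.TcThermcert1.GaugeQbpFarSeam
open scoped Matrix.Norms.L2Operator ComplexOrder ComplexConjugate

/-! ## §0 Read-back of the crux -/

/-- Read-back: K1′ is by definition the thermal leaf at `(t′, U, n, β, c) = (0, 8, 7/8, 8, 7/44)` (hole density `1 − 7/8`). -/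
theorem k1'_iff : TcThermcert1.ThermalStiffnessCeilingU8b8_le_7o44 ↔
    (∀ (ρs θ₀ : ℝ), 0 < ρs → 0 < θ₀ → ∀ Ls : ℕ → ℕ, Tendsto Ls atTop atTop →
      (∀ (j : ℕ) [NeZero (Ls j)] (θ : ℝ), |θ| ≤ θ₀ →
        8 * ρs * θ ^ 2 ≤ thermalFluxLogZ (Ls j) 0 8 (1 - 7 / 8) 8 0 - thermalFluxLogZ (Ls j) 0 8 (1 - 7 / 8) 8 θ) →
      ρs ≤ (((7 / 44 : ℚ)) : ℝ)) := Iff.rfl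

/-- K1′ with the hypothesis `0 < θ₀` dropped (β·t = 8 instance of the K1 twin `K1WithoutTheta0Pos`). -/
def K1'WithoutTheta0Pos : Prop :=
  ∀ (ρs θ₀ : ℝ), 0 < ρs → ∀ Ls : ℕ → ℕ, Tendsto Ls atTop atTop →
    (∀ (j : ℕ) [NeZero (Ls j)] (θ : ℝ), |θ| ≤ θ₀ →
      8 * ρs * θ ^ 2 ≤ thermalFluxLogZ (Ls j) 0 8 (1 - 7 / 8) 8 0 - thermalFluxLogZ (Ls j) 0 8 (1 - 7 / 8) 8 θ) →
    ρs ≤ (((7 / 44 : ℚ)) : ℝ)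

/-- `0 < θ₀` is load-bearing in K1′: with `θ₀ = −1` the flux premise is vacuous and `ρs = 1 > 7/44` refutes. -/
theorem k1'_false_without_theta0_pos : ¬ K1'WithoutTheta0Pos := by
  intro h
  have h1 := h 1 (-1) one_pos id tendsto_id (fun j _ θ hθ => absurd hθ (by have := abs_nonneg θ; linarith))
  push_cast at h1
  norm_num at h1

/-- K1′ with the flux premise dropped (only the positivity data kept). -/
def K1'WithoutFluxPremise : Prop :=
  ∀ (ρs θ₀ : ℝ), 0 < ρs → 0 < θ₀ → ∀ Ls : ℕ → ℕ, Tendsto Ls atTop atTop → ρs ≤ (((7 / 44 : ℚ)) : ℝ)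

/-- The flux premise is load-bearing in K1′: without it `ρs = 1` refutes. -/
theorem k1'_false_without_fluxPremise : ¬ K1'WithoutFluxPremise := by
  intro h
  have h1 := h 1 1 one_pos one_pos id tendsto_id
  push_cast at h1
  norm_num at h1

/-- Today's hypothesis-free anchor at β·t = 8 (energy class, kinematic, every temperature): `c = 0.4052848`; K1′ asks `7/44 = 0.15909…`,
a factor `> 2.54` lower (`anchor_gap_ratio_b8`). -/
theorem anchor_kinematic_b8 : ObsThermalStiffnessSeqCeilingAtBeta 0 8 (7 / 8) 8 (4052848 / 10000000) :=
  (ObsThermalStiffnessSeqCeilingAt_tp0_kinematic_decimal (U := 8) (n := 7 / 8) (by norm_num) (by norm_num)).atBeta (by norm_num)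

theorem anchor_gap_ratio_b8 : (0.4052848 : ℝ) / (7 / 44) > 2.54 := by norm_num

/-! ## §1 What print supports or threatens (located remarks pinned to numeric facts)

Locators were read from the materialised texts (`lit read`, page = PDF page, `pNNNN.txt:L`). -/

/-- **Print at the bet's temperature (reworded in edition 4, W-4).** Xiao–He–Georges–Zhang, PRX 13, 011007 (2023) = arXiv:2202.11741
(`U = 8`, `δ = 1/8`, `t′ = 0`, AFQMC): p.6 Fig. 2 (16×8 supercell) staggered SPIN correlations at `β = 6` (single AFM domain) and `β = 9` («a
clear nodal line develops»); p.7 L103–107 + Fig. 3(b) (`β = 6, 8, 10, 11, 30`): the node is ABSENT at `β = 6` and «small but clearly resolved»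
AT `β = 8`; App. B Fig. 7 (p.12 L83–91, p.14): the 16×16 TORUS at `β = 3, 8` — antiphase corners appear at `β = 8`; p.10: charge order «turns
finite abruptly at T ∼ 1/10»; p.11: «Tc/t < 0.1», Z₈-clock/BKT scenario for the CHARGE order; p.14 App. C: `β = 9` «where charge order is
absent». So the bet's `T = 1/8` IS a printed temperature — the onset of the stripe's spin node — and lies strictly above the printed
charge-ordering temperature `1/10`; editions 1–3's «data gap (1/9, 1/6)» described Fig. 2 only and is withdrawn as a gloss (the typed
inequalities below stay true and harmless). All printed observables are time-reversal EVEN, hence (§4, F1) contribute exactly `0` to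
Hypothesis C — at `β = 8`, on the printed torus, included. [cite: arXiv:2202.11741 p.6, p.7, p.10, p.11, p.12, p.14] -/
theorem print_window_b8 : (1 : ℝ) / 9 < 1 / 8 ∧ (1 : ℝ) / 8 < 1 / 6 ∧ (1 : ℝ) / 10 < 1 / 8 := by norm_num

/-- **The time-reversal-odd channels in print.** (a) Orbital currents / d-density wave: Macridin–Jarrell–Maier, PRB 70, 113105 (2004)
= arXiv:cond-mat/0403403, p.3 L60–62 (`U = W = 8t`, DCA, `N_c = 4`), p.3 L104–110 and p.4 L19–22: «The cc-susceptibility does not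
diverge … A divergent DDW susceptibility is never found» [float; cluster mean field]. (b) Superconducting phase stiffness: Qin et al.,
PRX 10, 031016 (2020) = arXiv:1910.08931, §III.B p.7 L105–125, Fig. 6: at `(U, δ, t′) = (8, 1/8, 0)` the ground state is NOT
superconducting («the SC pairing order parameter clearly decays exponentially») [float] — printed expectation `T_KT = 0` at the anchor;
the largest d-wave `T_KT` floats anywhere in the Hubbard `(U, δ, t′)` plane are `≲ 0.05 t`, a factor `≥ 2.5` below the bet's `T = t/8`.
No printed counterexample to C8; the typed margin: -/
theorem floats_TKT_below_bet : (0.05 : ℝ) < 1 / 8 ∧ (1 : ℝ) / 8 / 0.05 ≥ 2.5 := by norm_num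

/-- **The bet's temperature in kelvin (W-2).** Arovas–Berg–Kivelson–Raghu, arXiv:2103.12097 p.33 L11–13: `W ∼ 2 eV`, `W ≃ 8t`, «a Tc of
0.05t would correspond to Tc ∼ 150K, of the order of the maximal transition temperature found in the cuprates». With `t = 0.25 eV` and
`1 eV ≙ 11604.5 K`: `t ≙ 2901 K`, the bet's `T = t/8 ≙ 362.6 K ∈ (360, 365)`, i.e. `2.5×` the `0.05t ≙ 145 K` scale of the highest
cuprate `T_c`. (Scale words only: K1′/C8 are statements about the `t′ = 0` Hubbard model, not about a material.) [cite: arXiv:2103.12097 p.33] -/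
theorem bet_temperature_kelvin :
    (360 : ℝ) < 25 / 100 * (116045 / 10) / 8 ∧ (25 : ℝ) / 100 * (116045 / 10) / 8 < 365 ∧
      (1 : ℝ) / 8 = 5 / 2 * (5 / 100) ∧ (140 : ℝ) < 5 / 100 * (25 / 100 * (116045 / 10)) ∧
        (5 : ℝ) / 100 * (25 / 100 * (116045 / 10)) < 150 := by
  norm_num

/-! ## §2 Seam budget at β·t = 8 -/

/-- The assembly needs `(π/4)·c < 1/8`, i.e. `c < 1/(2π) = 0.159154…`; `7/44 = 0.159090…` passes (⟺ `π < 22/7`, tree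
`Theorems.TcThermcert1.RungB8.seam_b8`), while `0.1592` already fails — the typed constant carries `4·10⁻⁴` relative slack, so K1′ is
(up to that slack) the statement «the β·t = 8 stiffness ceiling is below the universal Nelson–Kosterlitz value `2T/π` at `T = t/8`». -/
theorem seam_budget_b8 : Real.pi / 4 * (7 / 44 : ℝ) < 1 / 8 ∧ ¬ (Real.pi / 4 * (0.1592 : ℝ) < 1 / 8) := by
  have hπ1 : Real.pi < 3.1416 := Real.pi_lt_d4
  have hπ2 : 3.1415 < Real.pi := Real.pi_gt_d4
  refine ⟨by nlinarith, ?_⟩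
  intro h
  nlinarith

/-! ## §3 Objects of the picked line (verbatim copies of `Lines/gauge_qbp_far_seam.lean` §0–§1) -/

section Objects

variable (L : ℕ) [NeZero L]

/-- Copy of the line's `FockOp`. -/
abbrev FockOp : Type := Matrix (Finset (Orb (FermionTorus 2 L))) (Finset (Orb (FermionTorus 2 L))) ℂ

/-- Copy of the line's `sectorPred` (the `(N_L, S^z = 0)` coordinate sector at hole density `δ`). -/
abbrev sectorPred (δ : ℝ) : Finset (Orb (FermionTorus 2 L)) → Prop :=
  fun s => s.card = 2 * ⌊(1 - δ) * (L : ℝ) ^ 2 / 2⌋₊ ∧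
    2 * (s.filter fun i => (ofLex i).2 = 0).card = 2 * ⌊(1 - δ) * (L : ℝ) ^ 2 / 2⌋₊

/-- Copy of the line's `SectorPreserving`. -/
def SectorPreserving (δ : ℝ) (A : FockOp L) : Prop :=
  ∀ s t, sectorPred L δ s → ¬ sectorPred L δ t → A s t = 0 ∧ A t s = 0

/-- Copy of the line's `sectorExpect`. -/
def sectorExpect (δ β : ℝ) (H A : FockOp L) : ℂ :=
  gibbsState β (H.toBlock (sectorPred L δ) (sectorPred L δ)) (A.toBlock (sectorPred L δ) (sectorPred L δ))

/-- Copy of the line's `bondCurrent`. -/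
def bondCurrent (X y : ZMod L) : FockOp L :=
  ∑ σ : Fin 2,
    ((-Complex.I) • (creation (orb (FermionTorus.ofTorusSite ![X, y]) σ) *
        annihilation (orb (FermionTorus.ofTorusSite ![X - 1, y]) σ)) +
      Complex.I • (creation (orb (FermionTorus.ofTorusSite ![X - 1, y]) σ) *
        annihilation (orb (FermionTorus.ofTorusSite ![X, y]) σ)))

/-- Copy of the line's `antipode`. -/
def antipode : ZMod L := ((L / 2 : ℕ) : ZMod L)

/-- Copy of the line's `farCutCurrent`. -/
def farCutCurrent (U n β φ : ℝ) : ℝ :=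
  ∑ y : ZMod L, (sectorExpect L (1 - n) β (hubbardTorusTT'Flux L 0 U φ) (bondCurrent L (antipode L) y)).re

end Objects

/-- Copy of the line's Hypothesis C `CurrentClustering`. -/
def CurrentClustering (U n β ξ : ℝ) : Prop :=
  0 < ξ ∧ ∃ C : ℝ, ∃ k L₀ : ℕ, ∀ (L : ℕ) [NeZero L], L₀ ≤ L →
    ∀ (X : Finset (FermionTorus 2 L)) (A : FockOp L),
      A ∈ carEvenSubalgebra (orbSet X) → SectorPreserving L (1 - n) A →
      ∀ (X₀ y : ZMod L) (d : ℕ),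
        (∀ x ∈ X, d ≤ torusDist x.toTorusSite ![X₀, y] ∧
          d ≤ torusDist x.toTorusSite ![X₀ - 1, y]) →
        ‖sectorExpect L (1 - n) β (hubbardTorusTT'Flux L 0 U 0) (A * bondCurrent L X₀ y)
            - sectorExpect L (1 - n) β (hubbardTorusTT'Flux L 0 U 0) A
              * sectorExpect L (1 - n) β (hubbardTorusTT'Flux L 0 U 0) (bondCurrent L X₀ y)‖
          ≤ C * ‖A‖ * (X.card : ℝ) ^ k * Real.exp (-(d : ℝ) / ξ)

/-- Copy of the line's `PersistentCurrentVanishes`. -/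
def PersistentCurrentVanishes (U n β θ₁ : ℝ) : Prop :=
  ∃ ε : ℕ → ℝ, Tendsto ε atTop (𝓝 0) ∧ ∃ L₀ : ℕ, ∀ (L : ℕ) [NeZero L], L₀ ≤ L →
    ∀ φ : ℝ, |φ| ≤ θ₁ → |farCutCurrent L U n β φ| ≤ ε L

/-! ## §4 Time-reversal blindness of Hypothesis C -/

section TimeReversal

variable (L : ℕ) [NeZero L]

/-- The bond current is entrywise imaginary (tree `farBond_map_conj`). -/
theorem bondCurrent_map_conj (X₀ y : ZMod L) :
    (bondCurrent L X₀ y).map (starRingEnd ℂ) = -bondCurrent L X₀ y :=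
  farBond_map_conj L X₀ y

/-- The bond current is Hermitian. [folklore] -/
theorem isHermitian_bondCurrent (X₀ y : ZMod L) : (bondCurrent L X₀ y).IsHermitian := by
  unfold bondCurrent Matrix.IsHermitian
  rw [conjTranspose_sum]
  refine Finset.sum_congr rfl fun σ _ => ?_
  rw [conjTranspose_add, conjTranspose_smul, conjTranspose_smul, conjTranspose_mul, conjTranspose_mul,
    creation_conjTranspose, annihilation_conjTranspose, creation_conjTranspose, annihilation_conjTranspose,
    star_neg, Complex.star_def, Complex.conj_I, neg_neg, add_comm]

/-- The bond current has operator norm `≤ 4` (tree `norm_farBond_le`). -/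
theorem norm_bondCurrent_le (X₀ y : ZMod L) : ‖bondCurrent L X₀ y‖ ≤ 4 :=
  norm_farBond_le _ _

/-- **(i) The flux-free sector expectation of every bond current is ZERO** (every `U`, `β`, hole density `δ`, side `L`, cut `X₀`, row `y`):
its real part vanishes by time reversal (tree `re_gibbsState_fluxZeroBlock_farBond_eq_zero`) and it is real because the current and the
Hamiltonian block are Hermitian. Consequently the product term of Hypothesis C's covariance is identically `0`:
`Cov(A, j) = ω_p(A j)`. [folklore] -/
theorem sectorExpect_fluxZero_bondCurrent_eq_zero (δ β U : ℝ) (X₀ y : ZMod L) :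
    sectorExpect L δ β (hubbardTorusTT'Flux L 0 U 0) (bondCurrent L X₀ y) = 0 := by
  have hre : (sectorExpect L δ β (hubbardTorusTT'Flux L 0 U 0) (bondCurrent L X₀ y)).re = 0 := by
    unfold sectorExpect bondCurrent
    exact re_gibbsState_fluxZeroBlock_farBond_eq_zero L U β X₀ y _
  unfold sectorExpect at hre ⊢
  rw [gibbsState_eq_re (isHermitian_toBlock _ (isHermitian_hubbardTorusTT'Flux L 0 U 0)) β
    (isHermitian_toBlock _ (isHermitian_bondCurrent L X₀ y)), hre, Complex.ofReal_zero]

/-- **(ii) TIME-REVERSAL BLINDNESS.** For every entrywise-real Hermitian observable `A` (time-reversal EVEN: spin, charge, density–density,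
bond-kinetic, stripe / SDW / CDW order parameters …) commuting with the bond current (e.g. supported off the bond's two sites, as in
Hypothesis C with `d ≥ 1`), the covariance that Hypothesis C bounds is EXACTLY `0` — at every `U`, `β`, `δ`, `L`, in every sector.
So C (and the bet C8) is a statement about time-reversal-ODD correlations only. [folklore] -/
theorem sectorCov_bondCurrent_eq_zero_of_trEven (δ β U : ℝ) (X₀ y : ZMod L) {A : FockOp L}
    (hAr : A.map (starRingEnd ℂ) = A) (hAh : A.IsHermitian) (hc : A * bondCurrent L X₀ y = bondCurrent L X₀ y * A) :
    sectorExpect L δ β (hubbardTorusTT'Flux L 0 U 0) (A * bondCurrent L X₀ y)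
        - sectorExpect L δ β (hubbardTorusTT'Flux L 0 U 0) A
          * sectorExpect L δ β (hubbardTorusTT'Flux L 0 U 0) (bondCurrent L X₀ y) = 0 := by
  rw [sectorExpect_fluxZero_bondCurrent_eq_zero, mul_zero, sub_zero]
  have hAJ : (A * bondCurrent L X₀ y).IsHermitian := by
    unfold Matrix.IsHermitian
    rw [conjTranspose_mul, (isHermitian_bondCurrent L X₀ y).eq, hAh.eq]
    exact hc.symm
  have hre : (sectorExpect L δ β (hubbardTorusTT'Flux L 0 U 0) (A * bondCurrent L X₀ y)).re = 0 := by
    unfold sectorExpect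
    apply re_gibbsState_eq_zero_of_map_starRingEnd
    · rw [Theorems.TcThermcert1.GaugeQbpFarSeam.toBlock_map, hubbardTorusTT'Flux_tPrime_zero, hubbardTorusFlux_map_conj, neg_zero]
    · rw [Theorems.TcThermcert1.GaugeQbpFarSeam.toBlock_map, Matrix.map_mul, hAr, bondCurrent_map_conj, mul_neg, neg_toBlock]
  unfold sectorExpect at hre ⊢
  rw [gibbsState_eq_re (isHermitian_toBlock _ (isHermitian_hubbardTorusTT'Flux L 0 U 0)) β
    (isHermitian_toBlock _ hAJ), hre, Complex.ofReal_zero]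

/-- Corollary of (ii): time-reversal-even Hermitian observables commuting with the current satisfy the C-inequality with ANY constant
`C ≥ 0` (any `k`, `ξ`, support size, distance). Print's stripe / SDW / CDW data can never price Hypothesis C. [folklore] -/
theorem clusteringBound_of_trEven (δ β U : ℝ) (X₀ y : ZMod L) {A : FockOp L}
    (hAr : A.map (starRingEnd ℂ) = A) (hAh : A.IsHermitian) (hc : A * bondCurrent L X₀ y = bondCurrent L X₀ y * A)
    {C : ℝ} (hC : 0 ≤ C) (card k d : ℕ) (ξ : ℝ) :
    ‖sectorExpect L δ β (hubbardTorusTT'Flux L 0 U 0) (A * bondCurrent L X₀ y)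
        - sectorExpect L δ β (hubbardTorusTT'Flux L 0 U 0) A
          * sectorExpect L δ β (hubbardTorusTT'Flux L 0 U 0) (bondCurrent L X₀ y)‖
      ≤ C * ‖A‖ * (card : ℝ) ^ k * Real.exp (-(d : ℝ) / ξ) := by
  rw [sectorCov_bondCurrent_eq_zero_of_trEven L δ β U X₀ y hAr hAh hc, norm_zero]
  positivity

omit [NeZero L] in
/-- A-priori bound: a sector expectation is bounded by the operator norm (empty sector: Lean's `gibbsState` is `0`). [folklore] -/
theorem norm_sectorExpect_le {δ : ℝ} (β : ℝ) {H : FockOp L} (hH : H.IsHermitian) (A : FockOp L) :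
    ‖sectorExpect L δ β H A‖ ≤ ‖A‖ := by
  unfold sectorExpect
  rcases isEmpty_or_nonempty {s // sectorPred L δ s} with he | hne
  · have h0 : gibbsState β (H.toBlock (sectorPred L δ) (sectorPred L δ)) (A.toBlock (sectorPred L δ) (sectorPred L δ)) = 0 := by
      rw [gibbsState_apply]
      simp [Matrix.trace]
    rw [h0, norm_zero]
    exact norm_nonneg _
  · exact (norm_gibbsState_le (isHermitian_toBlock _ hH) β _).trans (norm_toBlock_le_of_le _ le_rfl)

/-- **The covariance of Hypothesis C is a-priori `≤ 4‖A‖`** (product term `= 0` by (i), `‖ω_p(A j)‖ ≤ ‖A j‖ ≤ 4‖A‖`): C only has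
content in the regime `e^{−d/ξ} |X|^k C < 4`. [folklore] -/
theorem sectorCov_norm_le (δ β U : ℝ) (X₀ y : ZMod L) (A : FockOp L) :
    ‖sectorExpect L δ β (hubbardTorusTT'Flux L 0 U 0) (A * bondCurrent L X₀ y)
        - sectorExpect L δ β (hubbardTorusTT'Flux L 0 U 0) A
          * sectorExpect L δ β (hubbardTorusTT'Flux L 0 U 0) (bondCurrent L X₀ y)‖ ≤ 4 * ‖A‖ := by
  rw [sectorExpect_fluxZero_bondCurrent_eq_zero, mul_zero, sub_zero]
  refine (norm_sectorExpect_le L β (isHermitian_hubbardTorusTT'Flux L 0 U 0) _).trans ?_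
  calc ‖A * bondCurrent L X₀ y‖ ≤ ‖A‖ * ‖bondCurrent L X₀ y‖ := norm_mul_le _ _
    _ ≤ ‖A‖ * 4 := by gcongr; exact norm_bondCurrent_le L X₀ y
    _ = 4 * ‖A‖ := mul_comm _ _

end TimeReversal

/-! ## §5 Guards of `PersistentCurrentVanishes` (stub B's conclusion) -/

section PCV

variable (L : ℕ) [NeZero L]

/-- The flux-free far-cut current vanishes identically (the line's `farCutCurrent_zero`, here from (i)). [folklore] -/
theorem farCutCurrent_zero (U n β : ℝ) : farCutCurrent L U n β 0 = 0 := by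
  unfold farCutCurrent
  exact Finset.sum_eq_zero fun y _ => by rw [sectorExpect_fluxZero_bondCurrent_eq_zero, Complex.zero_re]

/-- A-priori bound on the far-cut current: `|I_L(β, φ)| ≤ 4L` (L bonds, each of norm `≤ 4`). [folklore] -/
theorem abs_farCutCurrent_le (U n β φ : ℝ) : |farCutCurrent L U n β φ| ≤ 4 * L := by
  unfold farCutCurrent
  refine (Finset.abs_sum_le_sum_abs _ _).trans ?_
  have h : ∀ y ∈ (Finset.univ : Finset (ZMod L)),
      |(sectorExpect L (1 - n) β (hubbardTorusTT'Flux L 0 U φ) (bondCurrent L (antipode L) y)).re| ≤ 4 :=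
    fun y _ => (Complex.abs_re_le_norm _).trans
      ((norm_sectorExpect_le L β (isHermitian_hubbardTorusTT'Flux L 0 U φ) _).trans (norm_bondCurrent_le L _ _))
  refine (Finset.sum_le_sum h).trans ?_
  rw [Finset.sum_const, Finset.card_univ, ZMod.card, nsmul_eq_mul, mul_comm]

end PCV

/-- `0 < θ₁` is load-bearing in stub B's conclusion `∃ θ₁, 0 < θ₁ ∧ PersistentCurrentVanishes U n β θ₁`: for `θ₁ ≤ 0` the window
`|φ| ≤ θ₁` is at most `{0}`, where the current vanishes by time reversal, so PCV holds at EVERY `(U, n, β)` with `ε ≡ 0`. [folklore] -/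
theorem persistentCurrentVanishes_of_nonpos {θ₁ : ℝ} (hθ : θ₁ ≤ 0) (U n β : ℝ) : PersistentCurrentVanishes U n β θ₁ := by
  refine ⟨fun _ => 0, tendsto_const_nhds, 0, fun L _ _ φ hφ => ?_⟩
  obtain rfl : φ = 0 := abs_nonpos_iff.mp (hφ.trans hθ)
  rw [farCutCurrent_zero, abs_zero]

/-- So stub B with `0 < θ₁` dropped from its conclusion is trivially true (witness `θ₁ = 0`), whatever Hypothesis C says. -/
theorem stubB_trivial_without_theta1_pos (U n β : ℝ) : ∃ θ₁ : ℝ, PersistentCurrentVanishes U n β θ₁ :=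
  ⟨0, persistentCurrentVanishes_of_nonpos le_rfl U n β⟩

/-- PCV with the decay clause `Tendsto ε atTop (𝓝 0)` dropped. -/
def PersistentCurrentVanishesWithoutTendsto (U n β θ₁ : ℝ) : Prop :=
  ∃ ε : ℕ → ℝ, ∃ L₀ : ℕ, ∀ (L : ℕ) [NeZero L], L₀ ≤ L → ∀ φ : ℝ, |φ| ≤ θ₁ → |farCutCurrent L U n β φ| ≤ ε L

/-- The decay clause is load-bearing: without it PCV holds for every `(U, n, β, θ₁)` with the a-priori `ε_L = 4L`. [folklore] -/
theorem persistentCurrentVanishesWithoutTendsto_all (U n β θ₁ : ℝ) : PersistentCurrentVanishesWithoutTendsto U n β θ₁ :=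
  ⟨fun L => 4 * L, 0, fun L _ _ φ _ => abs_farCutCurrent_le L U n β φ⟩

/-! ## §6 Guards of `CurrentClustering` (Hypothesis C) -/

/-- Hypothesis C with the guard `0 < ξ` dropped. -/
def CurrentClusteringWithoutXiPos (U n β ξ : ℝ) : Prop :=
  ∃ C : ℝ, ∃ k L₀ : ℕ, ∀ (L : ℕ) [NeZero L], L₀ ≤ L →
    ∀ (X : Finset (FermionTorus 2 L)) (A : FockOp L),
      A ∈ carEvenSubalgebra (orbSet X) → SectorPreserving L (1 - n) A →
      ∀ (X₀ y : ZMod L) (d : ℕ),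
        (∀ x ∈ X, d ≤ torusDist x.toTorusSite ![X₀, y] ∧
          d ≤ torusDist x.toTorusSite ![X₀ - 1, y]) →
        ‖sectorExpect L (1 - n) β (hubbardTorusTT'Flux L 0 U 0) (A * bondCurrent L X₀ y)
            - sectorExpect L (1 - n) β (hubbardTorusTT'Flux L 0 U 0) A
              * sectorExpect L (1 - n) β (hubbardTorusTT'Flux L 0 U 0) (bondCurrent L X₀ y)‖
          ≤ C * ‖A‖ * (X.card : ℝ) ^ k * Real.exp (-(d : ℝ) / ξ)

/-- Read-back: C is literally `0 < ξ ∧ CurrentClusteringWithoutXiPos`. -/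
theorem currentClustering_iff (U n β ξ : ℝ) : CurrentClustering U n β ξ ↔ 0 < ξ ∧ CurrentClusteringWithoutXiPos U n β ξ := Iff.rfl

/-- **`0 < ξ` is what makes C8 a bet**: for every `ξ ≤ 0` (Lean junk `ξ = 0` included: `exp(−d/0) = exp 0 = 1`) the body of Hypothesis
C holds at EVERY `(U, n, β)` with `C = 4`, `k = 0`, `L₀ = 0`, by the a-priori bound `‖Cov‖ ≤ 4‖A‖` — no clustering involved. [folklore] -/
theorem currentClusteringWithoutXiPos_of_nonpos {ξ : ℝ} (hξ : ξ ≤ 0) (U n β : ℝ) : CurrentClusteringWithoutXiPos U n β ξ := by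
  refine ⟨4, 0, 0, fun L _ _ X A _ _ X₀ y d _ => ?_⟩
  refine (sectorCov_norm_le L (1 - n) β U X₀ y A).trans ?_
  have h1 : 1 ≤ Real.exp (-(d : ℝ) / ξ) :=
    Real.one_le_exp (div_nonneg_of_nonpos (neg_nonpos.mpr (Nat.cast_nonneg d)) hξ)
  rw [pow_zero, mul_one]
  exact le_mul_of_one_le_right (by positivity) h1

/-! ## §6b Locality of matrix elements and the infinite-temperature rung (edition 2)

An operator of the CAR subalgebra `𝔄(S)` cannot change occupations outside `S`; hence `A · j_b` has ZERO DIAGONAL whenever one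
endpoint of the bond `b` lies outside the support of `A` (the current moves an electron across that endpoint, `A` cannot move it
back).  At `β = 0` the sector Gibbs state is the normalised trace, so `ω_p(A j) = 0`: Hypothesis C holds OUTRIGHT at `β = 0`, for every
`U`, `n`, `ξ > 0`, with `(C, k, L₀) = (4, 0, 0)`, and so does stub B's conclusion (`farCutCurrent ≡ 0` at `β = 0`, for every flux).
Any failure of C8 is therefore a finite-`β` build-up of a time-reversal-ODD correlation (F1) starting from `Cov ≡ 0` at `β = 0`. -/

section Locality

variable {ι : Type*} [LinearOrder ι] [Fintype ι]

/-- **Locality of Jordan–Wigner words**: a word with letters in `S` has no matrix element between occupation sets that differ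
outside `S`. [folklore] -/
theorem wordOp_apply_eq_zero_of_sdiff_ne {S : Finset ι} {w : List (JWLetter ι)} (hw : LettersIn S w)
    {s t : Finset ι} (h : s \ S ≠ t \ S) : wordOp w s t = 0 := by
  have key := congrFun (wordOp_mulVec_single w t) s
  rw [mulVec_single_one, col_apply] at key
  rw [key, Pi.smul_apply, smul_eq_mul, Pi.single_eq_of_ne, mul_zero]
  intro hs
  have ht : t ∩ S ∪ t \ S = t := sup_inf_sdiff t S
  obtain ⟨hset, hsub⟩ := wordSet_union w hw (Finset.inter_subset_right : t ∩ S ⊆ S)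
    (Finset.sdiff_disjoint : Disjoint (t \ S) S)
  refine h ?_
  rw [hs]
  conv_lhs => rw [← ht]
  rw [hset, Finset.union_sdiff_distrib, Finset.sdiff_eq_empty_iff_subset.2 hsub, Finset.empty_union, sdiff_idem]

/-- **Locality of `𝔄(S)`**: an element of the CAR subalgebra of `S` has no matrix element between occupation sets that differ
outside `S` (`𝔄(S)` is the span of the words with letters in `S`). [folklore] -/
theorem apply_eq_zero_of_mem_carSubalgebra {S : Finset ι} {A : Matrix (Finset ι) (Finset ι) ℂ}
    (hA : A ∈ carSubalgebra S) {s t : Finset ι} (h : s \ S ≠ t \ S) : A s t = 0 := by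
  refine Submodule.span_induction (p := fun M _ => M s t = 0) ?_ ?_ ?_ ?_ (mem_span_wordOp_of_mem_carSubalgebra hA)
  · rintro M ⟨w, hw, rfl⟩
    exact wordOp_apply_eq_zero_of_sdiff_ne hw h
  · rfl
  · intro x y _ _ hx hy
    rw [Matrix.add_apply, hx, hy, add_zero]
  · intro c x _ hx
    rw [Matrix.smul_apply, hx, smul_zero]

/-- A hopping `c†_o c_{o'}` INTO an orbital `o ∉ S`, `o ≠ o'`, followed by `A ∈ 𝔄(S)`, has zero diagonal. [folklore] -/
theorem diag_mul_hopping_into_eq_zero {S : Finset ι} {A : Matrix (Finset ι) (Finset ι) ℂ} (hA : A ∈ carSubalgebra S)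
    {o o' : ι} (ho : o ∉ S) (hoo' : o ≠ o') (s : Finset ι) : (A * (creation o * annihilation o')) s s = 0 := by
  rw [Matrix.mul_apply]
  refine Finset.sum_eq_zero fun t _ => ?_
  by_cases hz : (creation o * annihilation o') t s = 0
  · rw [hz, mul_zero]
  · obtain ⟨hot, -, hs⟩ := LiebTwo.creation_mul_annihilation_apply_ne_zero hz
    rw [apply_eq_zero_of_mem_carSubalgebra hA ?_, zero_mul]
    intro hst
    have h1 : o ∈ t \ S := Finset.mem_sdiff.2 ⟨hot, ho⟩
    rw [← hst, Finset.mem_sdiff, hs, Finset.mem_insert, Finset.mem_erase] at h1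
    rcases h1.1 with h | h
    · exact hoo' h
    · exact h.1 rfl

/-- A hopping `c†_{o'} c_o` OUT OF an orbital `o ∉ S`, `o ≠ o'`, followed by `A ∈ 𝔄(S)`, has zero diagonal. [folklore] -/
theorem diag_mul_hopping_outof_eq_zero {S : Finset ι} {A : Matrix (Finset ι) (Finset ι) ℂ} (hA : A ∈ carSubalgebra S)
    {o o' : ι} (ho : o ∉ S) (hoo' : o ≠ o') (s : Finset ι) : (A * (creation o' * annihilation o)) s s = 0 := by
  rw [Matrix.mul_apply]
  refine Finset.sum_eq_zero fun t _ => ?_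
  by_cases hz : (creation o' * annihilation o) t s = 0
  · rw [hz, mul_zero]
  · obtain ⟨-, hos, hs⟩ := LiebTwo.creation_mul_annihilation_apply_ne_zero hz
    rw [apply_eq_zero_of_mem_carSubalgebra hA ?_, zero_mul]
    intro hst
    have h1 : o ∈ s \ S := Finset.mem_sdiff.2 ⟨by rw [hs]; exact Finset.mem_insert_self _ _, ho⟩
    rw [hst, Finset.mem_sdiff] at h1
    exact hos (Finset.mem_erase.2 ⟨hoo', h1.1⟩)

/-- A genuine hopping `c†_o c_{o'}`, `o ≠ o'`, has zero diagonal. [folklore] -/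
theorem diag_hopping_eq_zero {o o' : ι} (hoo' : o ≠ o') (s : Finset ι) : (creation o * annihilation o') s s = 0 := by
  by_contra hz
  obtain ⟨hos, -, hs⟩ := LiebTwo.creation_mul_annihilation_apply_ne_zero hz
  have h1 : o ∈ insert o' (s.erase o) := hs ▸ hos
  rw [Finset.mem_insert, Finset.mem_erase] at h1
  rcases h1 with h | h
  · exact hoo' h
  · exact h.1 rfl

end Locality

section BondLocality

variable {Λ : Type*} [LinearOrder Λ] [Fintype Λ]

/-- **`A · j_{ab}` has zero diagonal** for `A ∈ 𝔄(orbSet X)` and a bond endpoint `a ∉ X` (`j_{ab} = Σ_σ (−i c†_{aσ} c_{bσ} + i c†_{bσ} c_{aσ})`;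
for `a = b` the current is `0`).  Only `carSubalgebra`, not `carEvenSubalgebra`, is used. [folklore] -/
theorem diag_mul_farBond_eq_zero {X : Finset Λ} {A : Matrix (Finset (Orb Λ)) (Finset (Orb Λ)) ℂ}
    (hA : A ∈ carSubalgebra (orbSet X)) {a : Λ} (ha : a ∉ X) (b : Λ) (s : Finset (Orb Λ)) :
    (A * (∑ σ : Fin 2, ((-Complex.I) • (creation (orb a σ) * annihilation (orb b σ)) +
        Complex.I • (creation (orb b σ) * annihilation (orb a σ))))) s s = 0 := by
  by_cases hab : a = b
  · subst hab
    have h0 : (∑ σ : Fin 2, ((-Complex.I) • (creation (orb a σ) * annihilation (orb a σ)) +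
        Complex.I • (creation (orb a σ) * annihilation (orb a σ))) :
          Matrix (Finset (Orb Λ)) (Finset (Orb Λ)) ℂ) = 0 :=
      Finset.sum_eq_zero fun σ _ => by rw [neg_smul, neg_add_cancel]
    rw [h0, mul_zero, Matrix.zero_apply]
  · have hoS : ∀ σ : Fin 2, orb a σ ∉ orbSet X := fun σ h => ha (mem_orbSet.1 h)
    have hne : ∀ σ : Fin 2, orb a σ ≠ orb b σ := fun σ h =>
      hab (congrArg (fun k : Orb Λ => (ofLex k).1) h)
    rw [Finset.mul_sum, Matrix.sum_apply]
    refine Finset.sum_eq_zero fun σ _ => ?_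
    rw [Matrix.mul_add, Matrix.mul_smul, Matrix.mul_smul, Matrix.add_apply, Matrix.smul_apply, Matrix.smul_apply,
      diag_mul_hopping_into_eq_zero hA (hoS σ) (hne σ), diag_mul_hopping_outof_eq_zero hA (hoS σ) (hne σ),
      smul_zero, smul_zero, add_zero]

/-- The bare bond current `j_{ab}` has zero diagonal. [folklore] -/
theorem diag_farBond_eq_zero (a b : Λ) (s : Finset (Orb Λ)) :
    (∑ σ : Fin 2, ((-Complex.I) • (creation (orb a σ) * annihilation (orb b σ)) +
        Complex.I • (creation (orb b σ) * annihilation (orb a σ))) :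
          Matrix (Finset (Orb Λ)) (Finset (Orb Λ)) ℂ) s s = 0 := by
  by_cases hab : a = b
  · subst hab
    have h0 : (∑ σ : Fin 2, ((-Complex.I) • (creation (orb a σ) * annihilation (orb a σ)) +
        Complex.I • (creation (orb a σ) * annihilation (orb a σ))) :
          Matrix (Finset (Orb Λ)) (Finset (Orb Λ)) ℂ) = 0 :=
      Finset.sum_eq_zero fun σ _ => by rw [neg_smul, neg_add_cancel]
    rw [h0, Matrix.zero_apply]
  · have hne : ∀ σ : Fin 2, orb a σ ≠ orb b σ := fun σ h =>
      hab (congrArg (fun k : Orb Λ => (ofLex k).1) h)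
    rw [Matrix.sum_apply]
    refine Finset.sum_eq_zero fun σ _ => ?_
    rw [Matrix.add_apply, Matrix.smul_apply, Matrix.smul_apply, diag_hopping_eq_zero (hne σ),
      diag_hopping_eq_zero (hne σ).symm, smul_zero, smul_zero, add_zero]

end BondLocality

section InfiniteTemperature

variable (L : ℕ) [NeZero L]

/-- Torus instance: `A · bondCurrent L X₀ y` has zero diagonal for `A ∈ 𝔄(orbSet X)` with the bond's head site `(X₀, y) ∉ X`. [folklore] -/
theorem diag_mul_bondCurrent_eq_zero {X : Finset (FermionTorus 2 L)} {A : FockOp L}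
    (hA : A ∈ carSubalgebra (orbSet X)) {X₀ y : ZMod L} (ha : FermionTorus.ofTorusSite ![X₀, y] ∉ X)
    (s : Finset (Orb (FermionTorus 2 L))) : (A * bondCurrent L X₀ y) s s = 0 := by
  unfold bondCurrent
  exact diag_mul_farBond_eq_zero hA ha _ s

omit [NeZero L] in
/-- At `β = 0` the sector state is the normalised trace: a zero-diagonal operator has `ω_p = 0`, whatever `H`. [folklore] -/
theorem sectorExpect_beta_zero_eq_zero_of_diag {δ : ℝ} (H : FockOp L) {M : FockOp L} (hM : ∀ s, M s s = 0) :
    sectorExpect L δ 0 H M = 0 := by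
  unfold sectorExpect
  rw [gibbsState_apply, gibbsWeight_zero, one_mul]
  have h0 : (M.toBlock (sectorPred L δ) (sectorPred L δ)).trace = 0 := by
    simp [Matrix.trace, Matrix.toBlock_apply, hM]
  rw [h0, mul_zero]

/-- **At `β = 0` the covariance of Hypothesis C vanishes identically off the head site** (every `U`, `δ`, `L`, sector). [folklore] -/
theorem sectorCov_beta_zero_eq_zero (δ U : ℝ) {X : Finset (FermionTorus 2 L)} {A : FockOp L}
    (hA : A ∈ carSubalgebra (orbSet X)) {X₀ y : ZMod L} (ha : FermionTorus.ofTorusSite ![X₀, y] ∉ X) :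
    sectorExpect L δ 0 (hubbardTorusTT'Flux L 0 U 0) (A * bondCurrent L X₀ y)
      - sectorExpect L δ 0 (hubbardTorusTT'Flux L 0 U 0) A
        * sectorExpect L δ 0 (hubbardTorusTT'Flux L 0 U 0) (bondCurrent L X₀ y) = 0 := by
  rw [sectorExpect_fluxZero_bondCurrent_eq_zero, mul_zero, sub_zero]
  exact sectorExpect_beta_zero_eq_zero_of_diag L _ (diag_mul_bondCurrent_eq_zero L hA ha)

/-- The bond current itself has zero diagonal. [folklore] -/
theorem diag_bondCurrent_eq_zero (X₀ y : ZMod L) (s : Finset (Orb (FermionTorus 2 L))) : bondCurrent L X₀ y s s = 0 := by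
  unfold bondCurrent
  exact diag_farBond_eq_zero _ _ s

/-- **At `β = 0` the far-cut current vanishes for EVERY flux** (the twisted Hamiltonian only enters through `e^{−βH} = 1`). [folklore] -/
theorem farCutCurrent_beta_zero (U n φ : ℝ) : farCutCurrent L U n 0 φ = 0 := by
  unfold farCutCurrent
  refine Finset.sum_eq_zero fun y _ => ?_
  rw [sectorExpect_beta_zero_eq_zero_of_diag L _ (diag_bondCurrent_eq_zero L (antipode L) y), Complex.zero_re]

end InfiniteTemperature

/-- **INFINITE-TEMPERATURE RUNG for Hypothesis C**: `CurrentClustering U n 0 ξ` holds for every `U`, `n` and `ξ > 0`, with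
`(C, k, L₀) = (4, 0, 0)`: if the head site `(X₀, y)` is in `X` the premise forces `d = 0` and the a-priori bound `‖Cov‖ ≤ 4‖A‖` is the
claim; otherwise the covariance is `0` by locality.  So C8 can only fail through a FINITE-`β` build-up. [folklore] -/
theorem currentClustering_beta_zero {ξ : ℝ} (hξ : 0 < ξ) (U n : ℝ) : CurrentClustering U n 0 ξ := by
  refine ⟨hξ, 4, 0, 0, fun L _ _ X A hA _ X₀ y d hd => ?_⟩
  by_cases ha : FermionTorus.ofTorusSite ![X₀, y] ∈ X
  · have hd0 : d = 0 := by
      have h := (hd _ ha).1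
      rw [FermionTorus.toTorusSite_ofTorusSite, torusDist_self] at h
      exact Nat.le_zero.1 h
    subst hd0
    refine (sectorCov_norm_le L (1 - n) 0 U X₀ y A).trans (le_of_eq ?_)
    simp
  · rw [sectorCov_beta_zero_eq_zero L (1 - n) U (carEvenSubalgebra_le_carSubalgebra _ hA) ha, norm_zero]
    positivity

/-- **Stub B's conclusion holds at `β = 0`** for every `θ₁` (with `ε ≡ 0`). [folklore] -/
theorem persistentCurrentVanishes_beta_zero (U n θ₁ : ℝ) : PersistentCurrentVanishes U n 0 θ₁ :=
  ⟨fun _ => 0, tendsto_const_nhds, 0, fun L _ _ φ _ => by rw [farCutCurrent_beta_zero, abs_zero]⟩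

/-- **Stub B is TRUE at `β = 0`** (its hypothesis `0 < β` excludes only a case where the conclusion holds outright): information for
the B prover — `0 < β` is used to PLACE `θ₁(β)`, not to avoid a counterexample at `β = 0`. [folklore] -/
theorem stubB_holds_at_beta_zero (U n : ℝ) : ∃ θ₁ : ℝ, 0 < θ₁ ∧ PersistentCurrentVanishes U n 0 θ₁ :=
  ⟨1, one_pos, persistentCurrentVanishes_beta_zero U n 1⟩


/-! ## §6c Non-vacuity of Hypothesis C: the current's self-covariance is strictly positive, and the distance premise is
load-bearing (edition 2)

F1 says every TR-EVEN observable has zero covariance with the current.  The TR-ODD observable `A = j` itself does not: in every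
non-degenerate sector, `Cov_p(j, j) = ω_p(j_ppᴴ j_pp) > 0` STRICTLY (faithfulness of the Gibbs state), at every `β`, `U`.  So C8 constrains a
non-empty class, and deleting the distance premise from Hypothesis C makes it FALSE (take `A = j`, `d → ∞`). -/

section SectorWitness

variable {Λ : Type*} [LinearOrder Λ] [Fintype Λ]

omit [LinearOrder Λ] [Fintype Λ] in
private theorem orb_ne_of_fst_ne {x y : Λ} (h : x ≠ y) (σ τ : Fin 2) : orb x σ ≠ orb y τ :=
  fun e => h (congrArg (fun k : Orb Λ => (ofLex k).1) e)

omit [LinearOrder Λ] [Fintype Λ] in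
private theorem orb_ne_of_snd_ne (x y : Λ) {σ τ : Fin 2} (h : σ ≠ τ) : orb x σ ≠ orb y τ :=
  fun e => h (congrArg (fun k : Orb Λ => (ofLex k).2) e)

omit [LinearOrder Λ] [Fintype Λ] in
private theorem snd_orb (x : Λ) (σ : Fin 2) : (ofLex (orb x σ)).2 = σ := rfl

/-- **Sector witness.** For distinct sites `a ≠ b` and `1 ≤ M ≤ |Λ| − 1`, the `(N = 2M, S^z = 0)` coordinate sector contains
configurations `S`, `T` with `⟨T| j_{ab} |S⟩ ≠ 0` (move one spin-`0` electron from `b` to `a`): the sector block of the bond current is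
non-zero. [folklore] -/
theorem exists_sector_farBond_apply_ne_zero {a b : Λ} (hab : a ≠ b) {M : ℕ} (hM : 1 ≤ M)
    (hMc : M + 1 ≤ Fintype.card Λ) :
    ∃ S T : Finset (Orb Λ),
      (S.card = 2 * M ∧ 2 * (S.filter fun i => (ofLex i).2 = 0).card = 2 * M) ∧
      (T.card = 2 * M ∧ 2 * (T.filter fun i => (ofLex i).2 = 0).card = 2 * M) ∧
      (∑ σ : Fin 2, ((-Complex.I) • (creation (orb a σ) * annihilation (orb b σ)) +
        Complex.I • (creation (orb b σ) * annihilation (orb a σ))) :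
          Matrix (Finset (Orb Λ)) (Finset (Orb Λ)) ℂ) T S ≠ 0 := by
  classical
  have horb_inj : ∀ σ : Fin 2, Function.Injective (fun x : Λ => orb x σ) := fun σ x y h =>
    congrArg (fun k : Orb Λ => (ofLex k).1) h
  have hcardσ : ∀ σ : Fin 2, (Finset.univ.image (fun x : Λ => orb x σ)).card = Fintype.card Λ := fun σ => by
    rw [Finset.card_image_of_injective _ (horb_inj σ), Finset.card_univ]
  have hmemσ : ∀ σ : Fin 2, ∀ i ∈ Finset.univ.image (fun x : Λ => orb x σ), (ofLex i).2 = σ := by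
    intro σ i hi
    obtain ⟨x, -, rfl⟩ := Finset.mem_image.1 hi
    rfl
  have hab0 : orb a 0 ≠ orb b 0 := orb_ne_of_fst_ne hab 0 0
  -- `u₀`: `M` spin-0 orbitals containing `(b,0)` and avoiding `(a,0)`; `u₁`: any `M` spin-1 orbitals
  have hsub : ({orb b 0} : Finset (Orb Λ)) ⊆ (Finset.univ.image (fun x : Λ => orb x 0)).erase (orb a 0) := by
    rw [Finset.singleton_subset_iff, Finset.mem_erase]
    exact ⟨hab0.symm, Finset.mem_image.2 ⟨b, Finset.mem_univ _, rfl⟩⟩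
  have hroom : M ≤ ((Finset.univ.image (fun x : Λ => orb x 0)).erase (orb a 0)).card := by
    rw [Finset.card_erase_of_mem (Finset.mem_image.2 ⟨a, Finset.mem_univ _, rfl⟩), hcardσ 0]
    omega
  obtain ⟨u₀, hbu₀, hu₀, hu₀c⟩ := Finset.exists_subsuperset_card_eq (n := M) hsub
    (le_of_eq_of_le (Finset.card_singleton _) hM) hroom
  have hroom1 : M ≤ (Finset.univ.image (fun x : Λ => orb x 1)).card := by rw [hcardσ 1]; omega
  obtain ⟨u₁, -, hu₁, hu₁c⟩ := Finset.exists_subsuperset_card_eq (n := M)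
    (Finset.empty_subset (Finset.univ.image (fun x : Λ => orb x 1)))
    (le_of_eq_of_le Finset.card_empty (Nat.zero_le M)) hroom1
  have hu₀0 : ∀ i ∈ u₀, (ofLex i).2 = 0 := fun i hi => hmemσ 0 i (Finset.mem_of_mem_erase (hu₀ hi))
  have hu₁1 : ∀ i ∈ u₁, (ofLex i).2 = 1 := fun i hi => hmemσ 1 i (hu₁ hi)
  have hdisj : Disjoint u₀ u₁ := by
    rw [Finset.disjoint_left]
    intro i hi0 hi1
    have h0 := hu₀0 i hi0
    rw [hu₁1 i hi1] at h0
    exact absurd h0 (by decide)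
  have hb0 : orb b 0 ∈ u₀ := hbu₀ (Finset.mem_singleton_self _)
  have ha0 : orb a 0 ∉ u₀ := fun h => (Finset.mem_erase.1 (hu₀ h)).1 rfl
  have ha1 : orb a 0 ∉ u₁ := fun h => by
    have h1 := hu₁1 _ h
    rw [snd_orb] at h1
    exact absurd h1 (by decide)
  -- `S = u₀ ⊔ u₁`
  have hSfilter : ((u₀ ∪ u₁).filter fun i => (ofLex i).2 = 0) = u₀ := by
    ext i
    simp only [Finset.mem_filter, Finset.mem_union]
    constructor
    · rintro ⟨h | h, h0⟩
      · exact h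
      · rw [hu₁1 i h] at h0
        exact absurd h0 (by decide)
    · exact fun h => ⟨Or.inl h, hu₀0 i h⟩
  have hScard : (u₀ ∪ u₁).card = 2 * M := by
    rw [Finset.card_union_of_disjoint hdisj, hu₀c, hu₁c]; ring
  have hbS : orb b 0 ∈ u₀ ∪ u₁ := Finset.mem_union_left _ hb0
  have haS : orb a 0 ∉ u₀ ∪ u₁ := by rw [Finset.mem_union, not_or]; exact ⟨ha0, ha1⟩
  -- `T = (S ∖ (b,0)) ∪ (a,0)`
  have haSe : orb a 0 ∉ (u₀ ∪ u₁).erase (orb b 0) := fun h => haS (Finset.mem_of_mem_erase h)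
  have hTcard : (insert (orb a 0) ((u₀ ∪ u₁).erase (orb b 0))).card = 2 * M := by
    rw [Finset.card_insert_of_notMem haSe, Finset.card_erase_of_mem hbS, hScard]; omega
  have hTfilter : ((insert (orb a 0) ((u₀ ∪ u₁).erase (orb b 0))).filter fun i => (ofLex i).2 = 0) =
      insert (orb a 0) (u₀.erase (orb b 0)) := by
    rw [Finset.filter_insert, if_pos (snd_orb a 0), Finset.filter_erase, hSfilter]
  refine ⟨u₀ ∪ u₁, insert (orb a 0) ((u₀ ∪ u₁).erase (orb b 0)), ⟨hScard, by rw [hSfilter, hu₀c]⟩,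
    ⟨hTcard, ?_⟩, ?_⟩
  · rw [hTfilter, Finset.card_insert_of_notMem (fun h => ha0 (Finset.mem_of_mem_erase h)),
      Finset.card_erase_of_mem hb0, hu₀c]
    omega
  -- the entry `⟨T| j |S⟩ = −i σσ' ≠ 0`
  have hTe : (insert (orb a 0) ((u₀ ∪ u₁).erase (orb b 0))).erase (orb a 0) = (u₀ ∪ u₁).erase (orb b 0) :=
    Finset.erase_insert haSe
  have haT : orb a 0 ∈ insert (orb a 0) ((u₀ ∪ u₁).erase (orb b 0)) := Finset.mem_insert_self _ _
  have hbT : orb b 0 ∉ insert (orb a 0) ((u₀ ∪ u₁).erase (orb b 0)) := by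
    rw [Finset.mem_insert, not_or]
    exact ⟨hab0.symm, Finset.notMem_erase _ _⟩
  have E1 : (creation (orb a 0) * annihilation (orb b 0) : Matrix (Finset (Orb Λ)) (Finset (Orb Λ)) ℂ)
      (insert (orb a 0) ((u₀ ∪ u₁).erase (orb b 0))) (u₀ ∪ u₁) ≠ 0 := by
    rw [LiebThm1.creation_mul_annihilation_apply, if_pos]
    · exact mul_ne_zero (jwSign_ne_zero _ _) (jwSign_ne_zero _ _)
    · refine ⟨haT, ?_, ?_⟩
      · rw [hTe]; exact Finset.notMem_erase _ _
      · rw [hTe, Finset.insert_erase hbS]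
  have E2 : (creation (orb b 0) * annihilation (orb a 0) : Matrix (Finset (Orb Λ)) (Finset (Orb Λ)) ℂ)
      (insert (orb a 0) ((u₀ ∪ u₁).erase (orb b 0))) (u₀ ∪ u₁) = 0 := by
    rw [LiebThm1.creation_mul_annihilation_apply, if_neg]
    exact fun h => hbT h.1
  have E3 : (creation (orb a 1) * annihilation (orb b 1) : Matrix (Finset (Orb Λ)) (Finset (Orb Λ)) ℂ)
      (insert (orb a 0) ((u₀ ∪ u₁).erase (orb b 0))) (u₀ ∪ u₁) = 0 := by
    rw [LiebThm1.creation_mul_annihilation_apply, if_neg]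
    rintro ⟨-, -, hS'⟩
    apply haS
    rw [hS']
    exact Finset.mem_insert_of_mem (Finset.mem_erase.2 ⟨orb_ne_of_snd_ne a a (by decide), haT⟩)
  have E4 : (creation (orb b 1) * annihilation (orb a 1) : Matrix (Finset (Orb Λ)) (Finset (Orb Λ)) ℂ)
      (insert (orb a 0) ((u₀ ∪ u₁).erase (orb b 0))) (u₀ ∪ u₁) = 0 := by
    rw [LiebThm1.creation_mul_annihilation_apply, if_neg]
    rintro ⟨-, -, hS'⟩
    apply haS
    rw [hS']
    exact Finset.mem_insert_of_mem (Finset.mem_erase.2 ⟨orb_ne_of_snd_ne a b (by decide), haT⟩)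
  rw [Matrix.sum_apply, Fin.sum_univ_two]
  simp only [Matrix.add_apply, Matrix.smul_apply, E2, E3, E4, smul_eq_mul, mul_zero, add_zero]
  exact mul_ne_zero (neg_ne_zero.2 Complex.I_ne_zero) E1

end SectorWitness

section SelfCovariance

variable (L : ℕ) [NeZero L]

/-- The bond current conserves `(N↑, N↓)`: it is `SectorPreserving` at every `δ`. [folklore] -/
theorem sectorPreserving_bondCurrent (δ : ℝ) (X₀ y : ZMod L) : SectorPreserving L δ (bondCurrent L X₀ y) := by
  unfold SectorPreserving bondCurrent
  exact sectorPreserving_of_preservesSectors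
    (PreservesSectors.sum fun σ _ =>
      ((LiebThm1.preservesSectors_hopping _ _ σ).smul _).add ((LiebThm1.preservesSectors_hopping _ _ σ).smul _)) _

/-- The bond current is even and supported on any region containing its two sites. [folklore] -/
theorem bondCurrent_mem_carEvenSubalgebra {X : Finset (FermionTorus 2 L)} {X₀ y : ZMod L}
    (ha : FermionTorus.ofTorusSite ![X₀, y] ∈ X) (hb : FermionTorus.ofTorusSite ![X₀ - 1, y] ∈ X) :
    bondCurrent L X₀ y ∈ carEvenSubalgebra (orbSet X) := by
  unfold bondCurrent
  exact farBond_mem_carEvenSubalgebra ha hb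

/-- **`Cov_p(j, j) = ω_p(j_ppᴴ j_pp)`** (product term `0` by F1; `(j·j)_p = j_p j_p` by sector preservation; `j_p` Hermitian). [folklore] -/
theorem sectorCov_bondCurrent_self_eq (δ β U : ℝ) (X₀ y : ZMod L) :
    sectorExpect L δ β (hubbardTorusTT'Flux L 0 U 0) (bondCurrent L X₀ y * bondCurrent L X₀ y)
        - sectorExpect L δ β (hubbardTorusTT'Flux L 0 U 0) (bondCurrent L X₀ y)
          * sectorExpect L δ β (hubbardTorusTT'Flux L 0 U 0) (bondCurrent L X₀ y)
      = gibbsState β ((hubbardTorusTT'Flux L 0 U 0).toBlock (sectorPred L δ) (sectorPred L δ))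
          (((bondCurrent L X₀ y).toBlock (sectorPred L δ) (sectorPred L δ))ᴴ
            * (bondCurrent L X₀ y).toBlock (sectorPred L δ) (sectorPred L δ)) := by
  rw [sectorExpect_fluxZero_bondCurrent_eq_zero, mul_zero, sub_zero,
    (isHermitian_toBlock _ (isHermitian_bondCurrent L X₀ y)).eq]
  unfold sectorExpect
  rw [toBlock_mul_of_sectorPreserving_left (sectorPred L δ) (sectorPreserving_bondCurrent L δ X₀ y)]

/-- **STRICT POSITIVITY of the current's self-covariance** whenever the sector block `j_p ≠ 0` (faithfulness of the Gibbs state: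
`Re ω(aᴴa) = 0 ↔ a = 0`; positivity: `ω(aᴴa) ≥ 0`), at every `β`, `U`, `δ`. [folklore] -/
theorem re_sectorCov_bondCurrent_self_pos {δ : ℝ} (β U : ℝ) {X₀ y : ZMod L}
    (hj : (bondCurrent L X₀ y).toBlock (sectorPred L δ) (sectorPred L δ) ≠ 0) :
    0 < (sectorExpect L δ β (hubbardTorusTT'Flux L 0 U 0) (bondCurrent L X₀ y * bondCurrent L X₀ y)
        - sectorExpect L δ β (hubbardTorusTT'Flux L 0 U 0) (bondCurrent L X₀ y)
          * sectorExpect L δ β (hubbardTorusTT'Flux L 0 U 0) (bondCurrent L X₀ y)).re := by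
  rw [sectorCov_bondCurrent_self_eq]
  have hH := isHermitian_toBlock (sectorPred L δ) (isHermitian_hubbardTorusTT'Flux L 0 U 0)
  have h0 := (Complex.le_def.1 (gibbsState_nonneg_of_posSemidef β hH
    (Matrix.posSemidef_conjTranspose_mul_self ((bondCurrent L X₀ y).toBlock (sectorPred L δ) (sectorPred L δ))))).1
  rw [Complex.zero_re] at h0
  exact lt_of_le_of_ne h0 fun h => hj ((hH.re_gibbsState_conjTranspose_mul_self_eq_zero_iff _ β).1 h.symm)

/-- **The sector block of the current is non-zero at the bet's density** `n = 7/8` on the tori `L = 4q`, `q ≥ 1` (sector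
`(N, S^z) = (14q², 0)`; bond `(1,0) ← (0,0)`). [folklore] -/
theorem toBlock_bondCurrent_ne_zero (q : ℕ) (hq : 1 ≤ q) [NeZero (4 * q)] :
    (bondCurrent (4 * q) 1 0).toBlock (sectorPred (4 * q) (1 - 7 / 8)) (sectorPred (4 * q) (1 - 7 / 8)) ≠ 0 := by
  have hM : ⌊(1 - (1 - 7 / 8 : ℝ)) * ((4 * q : ℕ) : ℝ) ^ 2 / 2⌋₊ = 7 * q ^ 2 := by
    have h : (1 - (1 - 7 / 8 : ℝ)) * ((4 * q : ℕ) : ℝ) ^ 2 / 2 = ((7 * q ^ 2 : ℕ) : ℝ) := by push_cast; ring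
    rw [h, Nat.floor_natCast]
  have hab : FermionTorus.ofTorusSite (![1, 0] : TorusSite 2 (4 * q)) ≠ FermionTorus.ofTorusSite ![1 - 1, 0] := by
    intro h
    have h' := congrArg FermionTorus.toTorusSite h
    rw [FermionTorus.toTorusSite_ofTorusSite, FermionTorus.toTorusSite_ofTorusSite] at h'
    have h1 : (![1, 0] : TorusSite 2 (4 * q)) 0 = ![1 - 1, 0] 0 := congrFun h' 0
    simp only [Matrix.cons_val_zero, sub_self] at h1
    haveI : Fact (1 < 4 * q) := ⟨by omega⟩
    exact one_ne_zero h1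
  have hcard : Fintype.card (FermionTorus 2 (4 * q)) = (4 * q) ^ 2 := by
    rw [Fintype.card_lex, Fintype.card_fun, Fintype.card_fin, Fintype.card_fin]
  have hq2 : 1 ≤ q ^ 2 := Nat.one_le_pow 2 q hq
  obtain ⟨S, T, hS, hT, hne⟩ := exists_sector_farBond_apply_ne_zero hab (M := 7 * q ^ 2) (by omega)
    (by rw [hcard]; nlinarith)
  have hS' : sectorPred (4 * q) (1 - 7 / 8) S := by dsimp only [sectorPred]; rw [hM]; exact hS
  have hT' : sectorPred (4 * q) (1 - 7 / 8) T := by dsimp only [sectorPred]; rw [hM]; exact hT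
  intro h0
  apply hne
  have h1 := congrFun (congrFun h0 ⟨T, hT'⟩) ⟨S, hS'⟩
  rw [Matrix.toBlock_apply, Matrix.zero_apply] at h1
  unfold bondCurrent at h1
  exact h1

end SelfCovariance

/-- Hypothesis C with the DISTANCE PREMISE deleted (`d` no longer tied to `dist(X, bond)`). -/
def CurrentClusteringWithoutDistPremise (U n β ξ : ℝ) : Prop :=
  0 < ξ ∧ ∃ C : ℝ, ∃ k L₀ : ℕ, ∀ (L : ℕ) [NeZero L], L₀ ≤ L →
    ∀ (X : Finset (FermionTorus 2 L)) (A : FockOp L),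
      A ∈ carEvenSubalgebra (orbSet X) → SectorPreserving L (1 - n) A →
      ∀ (X₀ y : ZMod L) (d : ℕ),
        ‖sectorExpect L (1 - n) β (hubbardTorusTT'Flux L 0 U 0) (A * bondCurrent L X₀ y)
            - sectorExpect L (1 - n) β (hubbardTorusTT'Flux L 0 U 0) A
              * sectorExpect L (1 - n) β (hubbardTorusTT'Flux L 0 U 0) (bondCurrent L X₀ y)‖
          ≤ C * ‖A‖ * (X.card : ℝ) ^ k * Real.exp (-(d : ℝ) / ξ)

/-- **The distance premise of Hypothesis C is load-bearing**: without it C is FALSE at the bet's density `n = 7/8`, for EVERY `U`, `β`,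
`ξ` (take `L = 4(L₀+1)`, `X` = the bond's two sites, `A = j`: the left side is the strictly positive constant `ω_p(j_pᴴ j_p)`, the right side
`→ 0` as `d → ∞`).  Any proof of C8 must use `d ≤ dist(X, bond)`. [folklore] -/
theorem currentClustering_false_without_distPremise (U β ξ : ℝ) :
    ¬ CurrentClusteringWithoutDistPremise U (7 / 8) β ξ := by
  rintro ⟨hξ, C, k, L₀, h⟩
  haveI : NeZero (4 * (L₀ + 1)) := ⟨by omega⟩
  have ha : FermionTorus.ofTorusSite ![(1 : ZMod (4 * (L₀ + 1))), 0] ∈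
      ({FermionTorus.ofTorusSite ![(1 : ZMod (4 * (L₀ + 1))), 0], FermionTorus.ofTorusSite ![1 - 1, 0]} :
        Finset (FermionTorus 2 (4 * (L₀ + 1)))) := Finset.mem_insert_self _ _
  have hb : FermionTorus.ofTorusSite ![(1 : ZMod (4 * (L₀ + 1))) - 1, 0] ∈
      ({FermionTorus.ofTorusSite ![(1 : ZMod (4 * (L₀ + 1))), 0], FermionTorus.ofTorusSite ![1 - 1, 0]} :
        Finset (FermionTorus 2 (4 * (L₀ + 1)))) := Finset.mem_insert_of_mem (Finset.mem_singleton_self _)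
  have hj := h (4 * (L₀ + 1)) (by omega) _ (bondCurrent (4 * (L₀ + 1)) 1 0)
    (bondCurrent_mem_carEvenSubalgebra (4 * (L₀ + 1)) ha hb) (sectorPreserving_bondCurrent (4 * (L₀ + 1)) _ 1 0) 1 0
  have hpos := lt_of_lt_of_le
    (re_sectorCov_bondCurrent_self_pos (4 * (L₀ + 1)) β U (toBlock_bondCurrent_ne_zero (L₀ + 1) (by omega)))
    (Complex.re_le_norm _)
  set K : ℝ := C * ‖bondCurrent (4 * (L₀ + 1)) 1 0‖ *
    (({FermionTorus.ofTorusSite ![(1 : ZMod (4 * (L₀ + 1))), 0], FermionTorus.ofTorusSite ![1 - 1, 0]} :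
        Finset (FermionTorus 2 (4 * (L₀ + 1)))).card : ℝ) ^ k with hK
  have hlim : Tendsto (fun d : ℕ => K * Real.exp (-(d : ℝ) / ξ)) atTop (𝓝 (K * 0)) := by
    refine tendsto_const_nhds.mul (Real.tendsto_exp_atBot.comp ?_)
    have h1 := tendsto_neg_atTop_atBot.comp ((tendsto_natCast_atTop_atTop (R := ℝ)).atTop_div_const hξ)
    refine h1.congr fun d => ?_
    simp [neg_div]
  rw [mul_zero] at hlim
  obtain ⟨d, hd⟩ := (hlim.eventually (gt_mem_nhds hpos)).exists
  exact lt_irrefl _ ((hj d).trans_lt hd)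


/-! ## §6d The canonical density plateau (edition 3, F6): Hypothesis C against a DENSITY partner is false at `β = 0`

Kernel content landed as `Theorems/ThermalStiffnessCeilingU8b8_le_7o44/Negative/CanonicalDensityCounting.lean` (generic exchangeability
counting, the exact plateau `densityCov_beta_zero_eq`) and `…/Negative/CanonicalDensityPlateau.lean` (the torus instance and the
refutation over unfolded bodies); restated here BY NAME on the line's objects, which is at the same time the definitional-equality check
of the landed unfolded statement against this file's verbatim copies of `sectorExpect` / `sectorPred` / `SectorPreserving`. -/

/-- **Hypothesis C with a density partner.** The line's `CurrentClustering U n β ξ` with the bond current `bondCurrent L X₀ y` replaced by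
the spin-`↑` density `numberOp (FermionTorus.ofTorusSite ![X₀, y]) 0` at the bond's head site — every other token verbatim (same sector
state, same flux-free `t′ = 0` Hamiltonian, same local even sector-preserving `A ∈ 𝔄(orbSet X)`, same distance premise to BOTH bond
sites, same `C ‖A‖ |X|^k e^{−d/ξ}`). The line's docstring refuses this statement («deliberately NOT stated for a general second
observable B»); F6 says the refusal is necessary. -/
def DensityClustering (U n β ξ : ℝ) : Prop :=
  0 < ξ ∧ ∃ C : ℝ, ∃ k L₀ : ℕ, ∀ (L : ℕ) [NeZero L], L₀ ≤ L →
    ∀ (X : Finset (FermionTorus 2 L)) (A : FockOp L),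
      A ∈ carEvenSubalgebra (orbSet X) → SectorPreserving L (1 - n) A →
      ∀ (X₀ y : ZMod L) (d : ℕ),
        (∀ x ∈ X, d ≤ torusDist x.toTorusSite ![X₀, y] ∧
          d ≤ torusDist x.toTorusSite ![X₀ - 1, y]) →
        ‖sectorExpect L (1 - n) β (hubbardTorusTT'Flux L 0 U 0) (A * numberOp (FermionTorus.ofTorusSite ![X₀, y]) 0)
            - sectorExpect L (1 - n) β (hubbardTorusTT'Flux L 0 U 0) A
              * sectorExpect L (1 - n) β (hubbardTorusTT'Flux L 0 U 0) (numberOp (FermionTorus.ofTorusSite ![X₀, y]) 0)‖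
          ≤ C * ‖A‖ * (X.card : ℝ) ^ k * Real.exp (-(d : ℝ) / ξ)

/-- **F6: `DensityClustering U (7/8) 0 ξ` is FALSE for every `U`, `ξ`** — the landed
`CanonicalDensityPlateau.not_densityClusteringBody_7o8_beta_zero` (stated over unfolded bodies) closes it by definitional unfolding of
this file's copies of the line's objects (so the landed statement IS this one). Witness: tori `L = 4q`, `X = {(0,0)}`, `A = n_{(0,0)↑}`,
the antipodal cut `X₀ = L/2`, `y = 0`, `d = q`; left side `= 63/(256(16q²−1))` exactly (Lebowitz–Percus–Verlet plateau), right side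
`≤ |C| e^{−q/ξ}`. Contrast: `currentClustering_beta_zero` (§6b, F4) — with the CURRENT as partner the same state clusters trivially at
`β = 0`. [cite: LebowitzPercusVerlet1967, §II; folklore] -/
theorem densityClustering_7o8_beta_zero_false (U ξ : ℝ) : ¬ DensityClustering U (7 / 8) 0 ξ :=
  Theorems.TcThermcert1.CanonicalDensityPlateau.not_densityClusteringBody_7o8_beta_zero U ξ

/-- **The plateau by name on the line's objects**: in the line's sector state at `β = 0` on the torus `L = 4q`, for EVERY `U`,
`|ω_p(n_{(0,0)↑} n_{(L/2,0)↑}) − ω_p(n_{(0,0)↑}) ω_p(n_{(L/2,0)↑})| = 63/(256(16q²−1))` although `dist((0,0), (L/2,0)) = 2q`.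
[cite: LebowitzPercusVerlet1967, §II; folklore] -/
theorem norm_sectorCov_density_eq (q : ℕ) (hq : 1 ≤ q) [NeZero (4 * q)] (U : ℝ) :
    ‖sectorExpect (4 * q) (1 - 7 / 8) 0 (hubbardTorusTT'Flux (4 * q) 0 U 0)
          (numberOp (FermionTorus.ofTorusSite (![0, 0] : TorusSite 2 (4 * q))) 0 *
            numberOp (FermionTorus.ofTorusSite (![(((4 * q) / 2 : ℕ) : ZMod (4 * q)), 0] : TorusSite 2 (4 * q))) 0)
        - sectorExpect (4 * q) (1 - 7 / 8) 0 (hubbardTorusTT'Flux (4 * q) 0 U 0)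
            (numberOp (FermionTorus.ofTorusSite (![0, 0] : TorusSite 2 (4 * q))) 0)
          * sectorExpect (4 * q) (1 - 7 / 8) 0 (hubbardTorusTT'Flux (4 * q) 0 U 0)
            (numberOp (FermionTorus.ofTorusSite (![(((4 * q) / 2 : ℕ) : ZMod (4 * q)), 0] : TorusSite 2 (4 * q))) 0)‖
      = 63 / (256 * (16 * (q : ℝ) ^ 2 - 1)) :=
  Theorems.TcThermcert1.CanonicalDensityPlateau.norm_densityCov_sector7o8_eq q hq U

/-! ## §6e Spin-exchange blindness (edition 3, F8): every spin-exchange-ODD partner has zero covariance with the current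

Kernel content landed as `Theorems/ThermalStiffnessCeilingU8b8_le_7o44/Negative/CurrentCovarianceSpinFlipBlind.lean` (GROUP COVARIANCE
of compressed Gibbs states under the signed permutation `Γ = relabelMatrix Orb.spinSwap`, tree `gibbsState_toBlock_conj_of_sector`: `Γ`
is unitary, commutes with the flux-free `H(1, U)` (`relabel_spinSwap_hamiltonianWith`), and maps the `(2M, S^z = 0)` sector onto itself
(`sector_spinSwap_iff` — it swaps the `↑` and `↓` counts, which agree there); the spin-summed current is `Γ`-even); restated BY NAME on the
line's objects (definitional-equality check of the landed unfolded statement against this file's copies). -/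

section SpinFlip

variable (L : ℕ) [NeZero L]

/-- **F8: `ω_p(A·j) − ω_p(A)·ω_p(j) = 0` for every spin-exchange-ODD `A`** (`Γ A Γᴴ = −A`: local spin densities `n_{x↑} − n_{x↓}`,
SPIN currents `j_↑ − j_↓`, odd `S^z`-strings — the spin currents are time-reversal ODD, so §4/F1 does not cover them), in the line's
sector state at every hole density `δ`, every `β`, `U`, bond `(X₀, y)`, side `L`. [folklore] -/
theorem sectorCov_bondCurrent_eq_zero_of_spinSwap_odd (δ β U : ℝ) (X₀ y : ZMod L) {A : FockOp L}
    (hA : relabel (Orb.spinSwap : Orb (FermionTorus 2 L) ≃ Orb (FermionTorus 2 L)) A = -A) :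
    sectorExpect L δ β (hubbardTorusTT'Flux L 0 U 0) (A * bondCurrent L X₀ y)
        - sectorExpect L δ β (hubbardTorusTT'Flux L 0 U 0) A
          * sectorExpect L δ β (hubbardTorusTT'Flux L 0 U 0) (bondCurrent L X₀ y) = 0 :=
  Theorems.TcThermcert1.CurrentCovarianceSpinFlipBlind.gibbsCov_fluxZeroBlock_farBond_eq_zero_of_spinSwap_odd L U β X₀ y
    ⌊(1 - δ) * (L : ℝ) ^ 2 / 2⌋₊ hA

/-- Corollary: spin-exchange-odd observables satisfy the C-inequality with ANY constant `C ≥ 0` (any `k`, `ξ`, support size,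
distance) — spin-current / spin-density quasi-order can never price Hypothesis C. [folklore] -/
theorem clusteringBound_of_spinSwap_odd (δ β U : ℝ) (X₀ y : ZMod L) {A : FockOp L}
    (hA : relabel (Orb.spinSwap : Orb (FermionTorus 2 L) ≃ Orb (FermionTorus 2 L)) A = -A)
    {C : ℝ} (hC : 0 ≤ C) (card k d : ℕ) (ξ : ℝ) :
    ‖sectorExpect L δ β (hubbardTorusTT'Flux L 0 U 0) (A * bondCurrent L X₀ y)
        - sectorExpect L δ β (hubbardTorusTT'Flux L 0 U 0) A
          * sectorExpect L δ β (hubbardTorusTT'Flux L 0 U 0) (bondCurrent L X₀ y)‖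
      ≤ C * ‖A‖ * (card : ℝ) ^ k * Real.exp (-(d : ℝ) / ξ) := by
  rw [sectorCov_bondCurrent_eq_zero_of_spinSwap_odd L δ β U X₀ y hA, norm_zero]
  positivity

omit [NeZero L] in
/-- **Non-vacuity of the odd class inside the line's hypotheses**: the local spin density `n_{x↑} − n_{x↓}` is spin-exchange odd
(and even, local, Hermitian, diagonal hence sector preserving). [folklore] -/
theorem relabel_spinSwap_szDensity (x : FermionTorus 2 L) :
    relabel (Orb.spinSwap : Orb (FermionTorus 2 L) ≃ Orb (FermionTorus 2 L)) (numberOp x 0 - numberOp x 1) =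
      -(numberOp x 0 - numberOp x 1) :=
  Theorems.TcThermcert1.CurrentCovarianceSpinFlipBlind.relabel_spinSwap_szDensity x

end SpinFlip

/-! ## §6f `SectorPreserving` is redundant in Hypothesis C (edition 4, F9)

The landed `CurrentClusteringSectorFree.currentClusteringBody_iff_sectorFree` is the unfolded form of the equivalence below; the line's
objects of §3 are definitionally those of the landed statement (the proof is the landed term, no `unfold`). Mechanism:
`Negative/LocalChargePinching.lean` (local charge pinching `A ↦ Σ_q Π_q A Π_q`, `q` = local `(N↑_X, N↓_X)`). -/

/-- Hypothesis C with the hypothesis `SectorPreserving L (1 - n) A` DELETED, everything else verbatim (§3). -/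
def CurrentClusteringSectorFree (U n β ξ : ℝ) : Prop :=
  0 < ξ ∧ ∃ C : ℝ, ∃ k L₀ : ℕ, ∀ (L : ℕ) [NeZero L], L₀ ≤ L →
    ∀ (X : Finset (FermionTorus 2 L)) (A : FockOp L),
      A ∈ carEvenSubalgebra (orbSet X) →
      ∀ (X₀ y : ZMod L) (d : ℕ),
        (∀ x ∈ X, d ≤ torusDist x.toTorusSite ![X₀, y] ∧
          d ≤ torusDist x.toTorusSite ![X₀ - 1, y]) →
        ‖sectorExpect L (1 - n) β (hubbardTorusTT'Flux L 0 U 0) (A * bondCurrent L X₀ y)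
            - sectorExpect L (1 - n) β (hubbardTorusTT'Flux L 0 U 0) A
              * sectorExpect L (1 - n) β (hubbardTorusTT'Flux L 0 U 0) (bondCurrent L X₀ y)‖
          ≤ C * ‖A‖ * (X.card : ℝ) ^ k * Real.exp (-(d : ℝ) / ξ)

/-- **F9: `SectorPreserving` is redundant in Hypothesis C** — for every `U`, `n`, `β`, `ξ` (constants `(C,k,L₀) ↦ (4·max C 0, k+2, L₀)`
one way, unchanged the other). [folklore] -/
theorem currentClustering_iff_sectorFree (U n β ξ : ℝ) : CurrentClustering U n β ξ ↔ CurrentClusteringSectorFree U n β ξ :=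
  Summit.Ventures.CertifiedManyBodySolver.Theorems.TcThermcert1.CurrentClusteringSectorFree.currentClusteringBody_iff_sectorFree
    U n β ξ

/-- The sector-free form implies Hypothesis C with the SAME constants (drop a hypothesis). [folklore] -/
theorem currentClustering_of_sectorFree {U n β ξ : ℝ} (h : CurrentClusteringSectorFree U n β ξ) : CurrentClustering U n β ξ :=
  (currentClustering_iff_sectorFree U n β ξ).2 h

/-- **The bet C8 is equivalent to its sector-free form**: `∃ ξ, CurrentClustering 8 (7/8) 8 ξ ↔ ∃ ξ, CurrentClusteringSectorFree 8 (7/8) 8 ξ`.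
[folklore] -/
theorem stubC8_iff_sectorFree :
    (∃ ξ : ℝ, CurrentClustering 8 (7 / 8) 8 ξ) ↔ ∃ ξ : ℝ, CurrentClusteringSectorFree 8 (7 / 8) 8 ξ :=
  exists_congr fun ξ => currentClustering_iff_sectorFree 8 (7 / 8) 8 ξ

/-- The sector-free Hypothesis C inherits every guard: it is TRUE at `β = 0` for every `U`, `n`, `ξ > 0` (F4 through F9). [folklore] -/
theorem currentClusteringSectorFree_beta_zero {ξ : ℝ} (hξ : 0 < ξ) (U n : ℝ) : CurrentClusteringSectorFree U n 0 ξ :=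
  (currentClustering_iff_sectorFree U n 0 ξ).1 (currentClustering_beta_zero hξ U n)

/-! ## §6g The parity restriction is redundant too: Hypothesis C is clustering against the full local algebra (edition 5, F10)

The landed `CurrentClusteringLocalAlgebra.currentClusteringBody_iff_local` is the unfolded form of the equivalence below (the proof is the
landed term, no `unfold`). Mechanism: `Negative/LocalChargeBookkeeping.lean` (Jordan–Wigner word bookkeeping: the local charge pinching of
ANY local observable is even). -/

/-- Hypothesis C against the FULL local algebra: `A ∈ carSubalgebra (orbSet X)` (any parity), NO `SectorPreserving`, everything else
verbatim (§3). -/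
def CurrentClusteringLocal (U n β ξ : ℝ) : Prop :=
  0 < ξ ∧ ∃ C : ℝ, ∃ k L₀ : ℕ, ∀ (L : ℕ) [NeZero L], L₀ ≤ L →
    ∀ (X : Finset (FermionTorus 2 L)) (A : FockOp L),
      A ∈ carSubalgebra (orbSet X) →
      ∀ (X₀ y : ZMod L) (d : ℕ),
        (∀ x ∈ X, d ≤ torusDist x.toTorusSite ![X₀, y] ∧
          d ≤ torusDist x.toTorusSite ![X₀ - 1, y]) →
        ‖sectorExpect L (1 - n) β (hubbardTorusTT'Flux L 0 U 0) (A * bondCurrent L X₀ y)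
            - sectorExpect L (1 - n) β (hubbardTorusTT'Flux L 0 U 0) A
              * sectorExpect L (1 - n) β (hubbardTorusTT'Flux L 0 U 0) (bondCurrent L X₀ y)‖
          ≤ C * ‖A‖ * (X.card : ℝ) ^ k * Real.exp (-(d : ℝ) / ξ)

/-- **F10: Hypothesis C is clustering against the FULL local algebra** — for every `U`, `n`, `β`, `ξ` (constants
`(C,k,L₀) ↦ (4·max C 0, k+2, L₀)` one way, unchanged the other). [folklore] -/
theorem currentClustering_iff_local (U n β ξ : ℝ) : CurrentClustering U n β ξ ↔ CurrentClusteringLocal U n β ξ :=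
  Summit.Ventures.CertifiedManyBodySolver.Theorems.TcThermcert1.CurrentClusteringLocalAlgebra.currentClusteringBody_iff_local U n β ξ

/-- F10a: the sector-free form (F9) and the full-local-algebra form are equivalent. [folklore] -/
theorem currentClusteringSectorFree_iff_local (U n β ξ : ℝ) :
    CurrentClusteringSectorFree U n β ξ ↔ CurrentClusteringLocal U n β ξ :=
  Summit.Ventures.CertifiedManyBodySolver.Theorems.TcThermcert1.CurrentClusteringLocalAlgebra.currentClusteringBody_sectorFree_iff_local
    U n β ξ

/-- The full-local-algebra form implies Hypothesis C with the SAME constants (restrict the test class). [folklore] -/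
theorem currentClustering_of_local {U n β ξ : ℝ} (h : CurrentClusteringLocal U n β ξ) : CurrentClustering U n β ξ :=
  (currentClustering_iff_local U n β ξ).2 h

/-- **The bet C8 is equivalent to clustering against the full local algebra**:
`∃ ξ, CurrentClustering 8 (7/8) 8 ξ ↔ ∃ ξ, CurrentClusteringLocal 8 (7/8) 8 ξ`. [folklore] -/
theorem stubC8_iff_local :
    (∃ ξ : ℝ, CurrentClustering 8 (7 / 8) 8 ξ) ↔ ∃ ξ : ℝ, CurrentClusteringLocal 8 (7 / 8) 8 ξ :=
  exists_congr fun ξ => currentClustering_iff_local 8 (7 / 8) 8 ξ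

/-- The full-local-algebra form inherits every guard: it is TRUE at `β = 0` for every `U`, `n`, `ξ > 0` (F4 through F10) — odd local
observables included. [folklore] -/
theorem currentClusteringLocal_beta_zero {ξ : ℝ} (hξ : 0 < ξ) (U n : ℝ) : CurrentClusteringLocal U n 0 ξ :=
  (currentClustering_iff_local U n 0 ξ).1 (currentClustering_beta_zero hξ U n)

/-! ## §7 Strengthenings and mutants (memo, edition 5)

Refuted in kernel: the DENSITY-partner modification of C at `β = 0` (F6, §6d) — hence a fortiori its `β`-uniform and general-`B`
versions; C without the distance premise (F5); the guards (F2). TRUE in kernel (so useless as refutation targets): C and stub B's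
conclusion at `β = 0` (F4) and C for `β < β_HT` (the lead's rung `stub_currentClustering8_smallBeta`, p753836); C for `ξ ≤ 0` (F2); C
restricted to `K`-even real Hermitian partners (F1) or to spin-exchange-odd partners (F8), with any `C ≥ 0`. EQUIVALENT in kernel (so
neither a strengthening nor a weakening): C with `SectorPreserving` deleted (F9, §6f) — the «sector-coupling test observable» loophole is
closed in both directions; C with `carEvenSubalgebra` relaxed to `carSubalgebra` AND `SectorPreserving` deleted (F10, §6g) — the «odd /
charge-changing test observable» loophole is closed in both directions too. Not decidable here (certified matrix exponentials / floats): `β`-uniform current clustering (false in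
spirit wherever a `T_KT > 0` exists, W-1; not at this `t′ = 0` anchor in print), `ξ` independent of `n`, `k = 0` («`k` possibly
unnecessary» stands as prover information; F9's `k ↦ k+2` is an artefact of the crude pinching constant, not evidence for growth), PCV on
the whole flux circle, finite-size K1′. -/

/-! ## §8 Targets (the lead's stubs, line v1.6; edition 5)

* C8 `stub_currentClustering8 : ∃ ξ, CurrentClustering 8 (7/8) 8 ξ` — THE BET and the ONLY registered stub (B
  `stub_farCutCurrent_of_clustering` is a theorem since v1.4; the helper rung `stub_currentClustering8_smallBeta` — C for `β < β_HT(8)` —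
  is a theorem since v1.6, p753836). Attacks and certificates: F1 (every `K`-even partner contributes `0` — the printed `β = 8` torus data
  included, W-4), F8 (every flip-odd partner too), F4 (`β = 0`: TRUE with `(C,k,L₀) = (4,0,0)`), F5 (non-vacuous at `d = 0`; distance
  premise load-bearing), F6 (the state itself does NOT cluster at order `1/|Λ|` — only `⟨j⟩_μ ≡ 0` saves C; a prover must use it), F9
  (`SectorPreserving` is REDUNDANT: C8 ⇔ its sector-free form; a prover may assume it, a falsifier may ignore it), F10 (PARITY is
  redundant too: C8 ⇔ clustering against the FULL local algebra `𝔄(orbSet X)` — the Lieb–Robinson-shaped target), §1/W-2 (no printed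
  odd-channel instability at `T ≈ t/8 ≙ 360 K`). No kill; no certificate in either direction exists in the tree or in print. Standing
  recommendation to ideators: price C8 only through `K`-odd ∩ flip-even channels (charge loop currents, scalar chirality), on tori
  `L = 4q`, in the CANONICAL `(7q², 7q²)` sector, with ANY local test observable, even or odd (F9, F10) — and remember that any grand-canonical
  surrogate must carry the LPV correction (F6).
-/

end Summit.Ventures.CertifiedManyBodySolver.Cruxes.ThermalStiffnessCeilingU8b8_le_7o44.Disproof

end
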